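import Summits.CriticalPhenomena.SAWScalingLimit.Theses.SAWLoopFugacityFlow
import Summits.CriticalPhenomena.SAWScalingLimit.Theorems.AvoidanceLimit.Negative.AvoidanceLimitExponentRigidity
import Summits.CriticalPhenomena.SAWScalingLimit.Theorems.SAWLoopFugacityFlowAvoidanceLimitAnchorDefs
import Summits.CriticalPhenomena.SAWScalingLimit.Theorems.SAWLoopFugacityFlowAvoidanceLimitSawEndpoint
import Summits.CriticalPhenomena.SAWScalingLimit.Theorems.SAWLoopFugacityFlowAvoidanceLimitVitaliTransport
import Summits.CriticalPhenomena.SAWScalingLimit.Theorems.SAWLoopFugacityFlowAvoidanceLimitSawCriticalPoint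
import Summits.CriticalPhenomena.SAWScalingLimit.Theorems.SAWLoopFugacityFlowAvoidanceLimitDeterminantal
import Summits.CriticalPhenomena.SAWScalingLimit.Theorems.SAWLoopFugacityFlowAvoidanceLimitExcursionRatioSelf
import Summits.CriticalPhenomena.SAWScalingLimit.Theorems.SAWLoopFugacityFlowAvoidanceLimitGreenRatioDecomposition
import Summits.CriticalPhenomena.SAWScalingLimit.Theorems.SAWLoopFugacityFlowAvoidanceLimitSphereRatioLimitAssembly
import Summits.CriticalPhenomena.SAWScalingLimit.Theorems.SAWLoopFugacityFlowAvoidanceLimitLatticeTopology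
import Summits.CriticalPhenomena.SAWScalingLimit.Theorems.SAWLoopFugacityFlowAvoidanceLimitRatioOscillationReduction
import Summits.CriticalPhenomena.SAWScalingLimit.Theorems.SAWLoopFugacityFlowAvoidanceLimitInteriorRatioLimitReduction
import Summits.CriticalPhenomena.SAWScalingLimit.Theorems.SAWLoopFugacityFlowAvoidanceLimitGreenConvergenceFromKernelConvergence
import Summits.CriticalPhenomena.SAWScalingLimit.Theorems.SAWLoopFugacityFlowAvoidanceLimitHarnackChainDefs
import Summits.CriticalPhenomena.SAWScalingLimit.Theorems.SAWLoopFugacityFlowAvoidanceLimitUniformBHPAssembly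
import Summits.CriticalPhenomena.SAWScalingLimit.Theorems.SAWLoopFugacityFlowAvoidanceLimitUniformBHPFromGerm
import Summits.CriticalPhenomena.SAWScalingLimit.Theorems.SAWLoopFugacityFlowAvoidanceLimitLocalConnectivity
import Summits.CriticalPhenomena.SAWScalingLimit.Theorems.SAWLoopFugacityFlowAvoidanceLimitAnnularReduction
import Summits.CriticalPhenomena.SAWScalingLimit.Theorems.SAWLoopFugacityFlowAvoidanceLimitGermHubGe
import Summits.CriticalPhenomena.SAWScalingLimit.Theorems.SAWLoopFugacityFlowAvoidanceLimitHubBox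
import Summits.CriticalPhenomena.SAWScalingLimit.Theorems.SAWLoopFugacityFlowAvoidanceLimitHubTwoSided
import Summits.CriticalPhenomena.SAWScalingLimit.Theorems.SAWLoopFugacityFlowAvoidanceLimitNestedGermArcs
import Summits.CriticalPhenomena.SAWScalingLimit.Theorems.SAWLoopFugacityFlowAvoidanceLimitGoodSeparator
import Summits.CriticalPhenomena.SAWScalingLimit.Theorems.SAWLoopFugacityFlowAvoidanceLimitFatSiteGood
import Summits.CriticalPhenomena.SAWScalingLimit.Theorems.SAWLoopFugacityFlowAvoidanceLimitWallsSeparate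
import Literature.Probability.LatticeModels.DiscreteGreenKernelConvergenceProofs
import Literature.Probability.LatticeModels.DiluteLoopModel
import Literature.Probability.RandomPlanarGeometry.HullSubdomainPullback
import Literature.Probability.RandomPlanarGeometry.JordanDomainProofs
import Literature.Probability.RandomPlanarGeometry.RestrictionHullsProofs

/-!
# Line `symplectic-fermion-anchor` for the crux `AvoidanceLimit` (stmt-CriticalPhenomena-10649)

Crux (route `SAWLoopFugacityFlow`, rank 2):
`Summit.CriticalPhenomena.SAWScalingLimit.Theses.SAWLoopFugacityFlow.AvoidanceLimit` — for every
Dobrushin domain `(D; a, b)`, hull subdomain `D'`, endpoint approximation, chordal uniformizer `φ`,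
pulled-back hull `A` and restriction data `(Φ, d = Φ'_A(0))`, the critical `δℤ²` SAW probability
`P_δ(range γ_δ ⊆ closure D')` tends to `d^(5/8)` as `δ → 0+`.

## The line (idea card `Ideas/symplectic-fermion-anchor.md`, triage r1-1/2/3: pass ×3)

Run the route's loop-fugacity continuation from the OTHER exactly solvable end of the strictly
dilute `ℤ²` family: the loop(`n`)+dimer(`t`) dressed self-avoiding walk
`Z_{n,t,x}(G, Λ; a, b) = Σ x^{#edges} n^{#loops} t^{#dimers}` (path `a → b`, vertex-disjoint simple
loops and doubled edges), taken along the path `(n, t, w) = (n, n/2, 0)`, `n ∈ [-2, 0]`: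

* at `(n, t, x) = (-2, -1, x)` it is DETERMINANTAL — `Z(G,Λ;a,b) = adj(1 - xA)_{ab}`,
  `Z(G,Λ;∅) = det(1 - xA)` (adjugate path expansion, `stub_determinantal`) — so at `x = 1/4` the
  doubly normalised two-leg ratio is a ratio of simple-random-walk Green's functions, whose limit
  `d = Φ'_A(0)^1` is discrete potential theory (`stub_excursionRatio`): the free symplectic fermion
  (`c = -2`, `κ = 2`, boundary weight `b = 1`) is the ANCHOR (`SymplecticAnchor`, proved here from the
  two stubs);
* the window out of the anchor (`stub_symplecticWindow : SymplecticAnchor → SymplecticWindow`,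
  the hardest stub: marginal constructive fermionic RG, `b(n) - 1 ≍ -(3/4π)√(n+2)`) gives
  `lim_δ R_δ(n) = d^{b(n)}` for `n ∈ (-2, -2+ε₀]` along the intrinsic critical curve `xcDim n (n/2)`;
* `δ`-uniform analyticity/boundedness of `n ↦ R_δ(n)` on complex neighbourhoods of `[-2+η, 0]`
  for every `η > 0` — NOT of the anchor, which is a square-root branch point of `b` (triage r1-1,
  r1-3) — (`stub_fugacityContinuation`) and a Vitali–Porter + identity-theorem transport lemma
  specific to the Coulomb-gas exponent `bExp` (`stub_vitaliTransport`) give `lim_δ R_δ(0) = d^{5/8}`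
  (`bExp 0 = 5/8`, kernel-checked below);
* at `(0, 0, x_c)` the ratio IS the SAW avoidance probability of the crux, on the nose
  (`stub_sawEndpoint`: the numerator lives on the CONFINED graph — `Ω_δ`-edges whose closed segment
  stays in `closure D'` — so no largest-component bookkeeping appears), once the intrinsic curve is
  identified at the SAW end, `xcDim 0 0 = 1/μ(ℤ²)` (`stub_sawCriticalPoint`, Hammersley–Welsh).

`AvoidanceLimit_of` composes the seven registered stubs into the crux BY NAME (no `sorry` outside
`stub_*`). Disproof.lean (cdisprove cycle 1) honoured: chordal `φ` and both normalisations of `Φ_A`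
are used at `stub_excursionRatio`/`stub_symplecticWindow` (they pin WHICH prime ends carry the two
legs and the value `d`) and in the glue (`0 < d` via `IsStarHull.pullbackHull` — hull identification
+ chordal `φ`); reachability is used in the glue (`eventually_good`) and in `stub_sawEndpoint`; the
ε-ball clause is kept verbatim everywhere (near-miss `WithoutBall`). Landed `Negative/` lemmas
imported: `avoidanceLimit_not_exp` (no exponent-blind argument can close the crux — here `5/8` enters
as `bExp 0`, the Coulomb-gas exponent continued from the window), `restrictionDeriv_lt_one`.

## Build status (lead -0 prover-line-stmt-CriticalPhenomena-10649-0, then continuation lead c1, 2026-08-16)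

The objects of §§1–3 of the planner's skeleton now live in the landed, reviewed module
`Theorems/SAWLoopFugacityFlowAvoidanceLimitAnchorDefs.lean` (namespace `…Theorems.AvoidanceLimit.Anchor`,
p83744; `xcDim` RESHAPED there to the sign-robust radius of convergence via `chiCoeff` after the lead's audit F0)
and are imported here. Landed stubs (sorry-free, `--supports stmt-CriticalPhenomena-10649`):
`Anchor.stub_sawEndpoint` (S1, p90984), `Anchor.stub_determinantal` (S2, p93840; helpers p91155 Matrix,
p91341 Configs, p83569 Loops, p92568 Strands, p93781 LoopGas), `Anchor.stub_vitaliTransport` (S6, p86507),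
`Anchor.stub_sawCriticalPoint` (S7, p88356). v4 (lead c1): S2 folded in — the composition `AvoidanceLimit_of`
now takes exactly the three OPEN stubs as hypotheses. Open: S3 `stub_excursionRatio` (reduced to ONE missing
δ-uniform Green's-function-ratio invariance principle, `Anchor.stub_excursionRatio_of_greenRatioInvariance`,
p90769; Neumann series p89449, continuum half p89785, walk-sum bridge p90363 landed; lead c1 holds it),
S5 `stub_fugacityContinuation` (open = FugacityAnalyticity on [-2+η,0]; structural helpers p91939, p92188 landed),
S4 `stub_symplecticWindow` (the bet; assessed crux-sized by lead -0, LeadReport.md).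

v7 (lead c1, end of its cycle 1): TOP closed (`Anchor.stub_latticeTopology`, p104172); BHP and INT DERIVED from two
new registered stubs through the landed reductions `Anchor.stub_ratioOscillation_of_uniformBHP` (p106247) and
`Anchor.stub_interiorRatioLimit_of_greenConvergence` (p105941): UBHP `stub_uniformBHP` (uniform discrete boundary
Harnack principle for the edge-killed `Ω_δ`-walk at a marked prime end) and GC `stub_greenConvergence` (interior
convergence of the confined killed-SRW Green's function). v8 (lead c2 prover-line-stmt-CriticalPhenomena-10649-c2-0,
this file): the composition `AvoidanceLimit_of` takes exactly the four OPEN stubs UBHP, GC, S4, S5; GC is being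
reduced to the PRINTED Chelkak–Wan Cor. 3.3 (`Literature.Probability.LatticeModels.killedGreen_tendsto_of_kernelConvergence`)
by a lattice sandwich between hole-free induced inner/outer approximants (lead c2 programme, helper files
`Theorems/SAWLoopFugacityFlowAvoidanceLimitGreenConvergence*.lean`). v9 (lead c2, end of cycle 1): that reduction has
LANDED (`Anchor.stub_greenConvergence_of_killedGreen_tendsto`, ten helper files), so GC is now DERIVED from the new
registered stub `stub_killedGreenKernelConvergence`, whose statement is VERBATIM the tree's Literature named fact
`Literature.Probability.LatticeModels.killedGreen_tendsto_of_kernelConvergence` (Chelkak–Wan 2021 Cor. 3.3 as printed,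
unproved in the tree): the composition `AvoidanceLimit_of` takes UBHP, CW33, S4, S5.

v10 (lead c3 prover-line-stmt-CriticalPhenomena-10649-c3-0, 2026-08-16): CW33 is CLOSED — the Literature fact has been
DISCHARGED in the tree (`Literature.Probability.LatticeModels.killedGreen_tendsto_of_kernelConvergence_holds`,
`DiscreteGreenKernelConvergenceProofs.lean`, literature-prover seat), so GC is an unconditional theorem
(`Anchor.stub_greenConvergence`, p118884) and the composition `AvoidanceLimit_of` takes exactly THREE stubs: UBHP (the one
honest lattice debt of the anchor: uniform discrete boundary Harnack for the EDGE-killed `Ω_δ`-walk, shared verbatim with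
stmt-CriticalPhenomena-11196 and with `KozdronLawler2005_martinRatioBoundaryLimit_of_greenConvergence_of_uniformBHP`), S4, S5
(open problems). Toward UBHP, lead c3 landed the step-zero bricks for the edge-killed walk (all `--supports`, namespace
`…Theorems.AvoidanceLimit.Anchor`): `isLatticeSubharmonicOn_dite_of_transition_mulVec_eq` (zero extension of a nonnegative
`P`-harmonic function is lattice-subharmonic, p118021), `transitionHarmonic_weakBeurling` (weak Beurling / Hölder decay at a
boundary point of a Jordan domain, eventually in `δ`, p117921), `transitionHarmonic_eq_sum_greenEntry_mul` (exit representation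
through `greenEntry H T`, p118363), `transitionHarmonic_harnack_box` (interior one-scale Harnack on full boxes, p118537),
`discreteDomainGraph_full_on_box` (boxes deep inside the domain are full in `Ω_δ`, p118740).

v11 (lead c4 prover-line-stmt-CriticalPhenomena-10649-c4-0, 2026-08-16): UBHP is RESHAPED and DERIVED. Architecture: Chelkak–Wan's
iteration along the EUCLIDEAN boundary Harnack chain of the edge-killed walk built from `Θ^far(σ)` = vertices that cannot reach
distance `R` from `p` avoiding `B(p, σ)` (inside `B(p,R)` by definition — the replacement of CW's `Θ_o(r)` forced by LOCAL harmonicity),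
`S_j = chainS(σ₀2^{-j})` (anchored cluster + exits), `R_j` = its `Λ`-interior (`Theorems/…HarnackChainDefs.lean`, p121898). Landed:
the lattice adapter `transitionHarmonic_crossDiff_iterate(_exit)` (p121445/p121674), the chain bookkeeping (`chainS_subset_chainR_of_le`,
`dist_lt_of_mem_chainS`, `mem_farCluster_of_walk`), the assembly `uniformBHP_of_localConnectivity_of_crossRatio`, and (T) = lattice
uniform local connectivity of Jordan domains at a boundary point — CLOSED (`latticeLocalConnectivity` p122661 = `latticeLocalConnectivity_of` p122370 fed by
`exists_localJordanNbhd` p122428 (Carathéodory chart p121453 + half-disc image) and `exists_discreteDomainGraph_walk_of_reachable` p122301, over the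
tree's macroscopic-diameter criterion `JordanDomain.exists_mem_meshDomain_of_reachable`); assembly `uniformBHP_of_localConnectivity_of_crossRatio` p122639. So `stub_uniformBHP` is DERIVED from the ONE new
registered stub `stub_annularCrossRatio` (the per-scale cross-ratio bound for the exit kernels of the chain, constant uniform in the scale
and the mesh: Chelkak–Wan Lemma 3.7's analytic input for the edge-killed walk = Chelkak's 2016 toolbox, factorisation Thm 3.5 /
cross-ratio vs extremal length Thm 7.1 / Prop 6.2, for `(V, E_int)` subdomains of `ℤ²`), and `AvoidanceLimit_of` takes
`stub_annularCrossRatio`, S4, S5.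

v12 (lead c5 prover-line-stmt-CriticalPhenomena-10649-c5-0, 2026-08-17): the cross-ratio debt is MOVED onto the tree's
germ-region chain. Independently of this line, `Literature/Probability/LatticeModels/UniformBHPFromCrossRatio.lean`
(with `Topology/PlaneTopology/GermRegions.lean`, `GermRegionLattice.lean` and the killed-walk toolbox
`KilledWalkLaplacian/Green/Harnack/HubFactorisation/EntranceDecomposition/BoxHitting.lean`) runs Chelkak–Wan's
iteration over the lattice GERM REGIONS `Θ_δ(s) = germSites D b s g o δ` (the part of `Ω_δ` on `b`'s side of the gate of
the box `box b s` facing a far point `o` — Chelkak–Wan's own `Θ(r)`, boxes for discs; its continuum topology —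
`germRegion_subset_closedBall`, `germRegion_mono`, exits through the single gate — is PROVED there) and reduces UBHP,
in the killed-average vocabulary, to ONE input `hcore`: the one-annulus cross-ratio bound for the exit kernels
`killedPoisson (Ω_δ) Θ_δ(s')` between the exits of `Θ_δ(s)` and of `Θ_δ(s')`, `s' = K s` (Chelkak–Wan 2021 Prop. 3.6 /
Chelkak 2016 §3 for the edge-killed walk). The landed dictionary `Anchor.uniformBHP_of_germCrossRatio` (p135980:
`(¼·adjMat H Λ) h = killedAvg H h̃` for the zero extension `h̃`) derives `stub_uniformBHP` VERBATIM from `hcore`, so the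
registered stub of this line is now `stub_germCrossRatio := hcore` — the SAME statement on which the Literature fact
`KozdronLawler2005_martinRatioBoundaryLimit` (route SAWExcursionCardy) rests (`…_of_crossRatio`). The c4 stub
`stub_annularCrossRatio` (Euclidean `Θ^far` chain) is RETIRED unrefuted: its analytic content is the same toolbox
theorem, but its chain needs a separate finiteness-of-bad-scales topology (two-mouth scales, foreign anchors) that the
germ-region chain has already discharged; c4's assembly/reduction files stay in the tree as landed `--supports`.
`AvoidanceLimit_of` takes `stub_germCrossRatio`, S4, S5.

v13 (lead c6 prover-line-stmt-CriticalPhenomena-10649-c6-0, 2026-08-17): the cross-ratio bound is DERIVED from the hub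
factorisation behind it. New registered stub `stub_germTwoSided` (`GermTwoSided`: eventually in `δ`, the exit kernel on
(inner exits) × (outer exits) is two-sidedly comparable to a product `f(u) g(x)`, constants uniform in the scale —
Chelkak 2016 Prop. 3.1/3.3 for the edge-killed walk); `stub_germCrossRatio` follows by the glue
`germCrossRatio_of_twoSided` (`C = (C₀/c₀)²`). The lemma-level blueprint of `stub_germTwoSided` (hub box in the middle
ring with two-sided lateral harmonic measures, harmonic-measure truncation, Whitney-ball walls, shield + lattice Beurling
at the landings, Newman separation through the germ region as a Jordan domain) is `Cruxes/AvoidanceLimit/NOTES.md`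
§"hcore blueprint (lead c6)". `AvoidanceLimit_of` takes `stub_germTwoSided`, S4, S5.

v14 (lead c7 prover-line-stmt-CriticalPhenomena-10649-c7-0, 2026-08-17): the HUB EXISTS and the two-sided statement is split at
the hub. Landed this session (all `--supports`): `sum_killedPoisson_mul_hitProb_le` / `killedPoisson_le_of_goodSeparator`
(p164062, exact strong Markov + "good separator ⇒ upper bound"), `ring_twoSided` (p165004), `lateral_oneSided` (p165660),
`threeScale_germArcs` (p166322), `germHub_of_threeScale` (p166980) and `germHub_ge` (p169304: a two-sided site `z ∈ Θ' ∖ Θ(s)`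
in the middle ring, macroscopically inside `D`, `h_T(z), h_B(z) ≥ 1/10`, for EVERY ring parameter `Λ' ≥ Λ`),
`exists_clean_hubBox` (p168371: its clean Whitney box), `fatSite_good` (p169236: fat wall sites are good), `walls_separate`
(p170378 + p169913: two lattice walls ending at a T-death and a B-death separate inner from outer exits). New registered stub
`stub_germUpper` (`GermUpper`: the factorisation UPPER bound `P(u,x) ≤ C₀·hitProb_{hub}(u)·P(z,x)` for every admissible hub
datum — Chelkak 2016 Prop. 3.3 for the edge-killed walk; the audit of its wall/tail design is crux NOTES.md §"hcore after lead
c7"); `stub_germTwoSided` is now DERIVED (`germTwoSided_of_upper`: lower bound = `hub_twoSided` on the clean hub box, hub from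
`germHub_ge` + `exists_clean_hubBox`, arcs from `exists_nested_germArcs`). `AvoidanceLimit_of` takes `stub_germUpper`, S4, S5.
-/

noncomputable section

open scoped BigOperators Topology symmDiff Classical
open Filter Finset
open Literature.Probability.RandomPlanarGeometry Literature.Probability.LatticeModels
open Summit.CriticalPhenomena.SAWScalingLimit.Theses.SAWLoopFugacityFlow (AvoidanceLimit)
open Summit.CriticalPhenomena.SAWScalingLimit.Theorems.AvoidanceLimit.Anchor
  (covered dimerConfigs dimerPF twoLegDim ratioDim map_dimerPF map_twoLegDim map_ratioDim confinedGraph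
    confinedGraph_le confinedGraph_le_zdGraph Rδ map_Rδ Rδ_ofReal halfPlaneSusceptibilityDim chiCoeff xcDim bExp
    bExp_neg_two bExp_zero bExp_one adjMat greenEntry greenRatio eventually_greenEntry_pos
    chainS chainR exitKernel)
open Literature.Topology.PlaneTopology (closedBox boxJD TwoOff germRegion gateArc gateLo gateHi germGateParam germGate
  germGate_subset_square subset_gateSide_of_isPreconnected mem_box_iff_abs germRegion_subset_carrier)

namespace Summit.CriticalPhenomena.SAWScalingLimit.Cruxes.AvoidanceLimit.SymplecticFermionAnchor

/-! ## 4. The statements of the line -/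

/-- **S1 · SAWEndpointIdentity** (lattice identity at the SAW end, provable now, M). For bounded `Ω`,
`δ > 0` and `a ≠ b`, the critical-SAW probability that the polyline stays in `closure S` EQUALS the
doubly normalised ratio `R_δ(0, 0, x_c; Ω, S)`: at `(n, t) = (0, 0)` only `M = ∅` and the
collision-free, loop-free configurations survive (`partitionFunction_zero_zero`), i.e. the
self-avoiding PATHS `a → b` (of the confined graph in the numerator: polyline `⊆ closure S` iff every
closed edge segment is), with `Z(·; ∅) = 1` (`partitionFunction_zero_zero_empty`), matching
`SAW.law = weight/weight(univ)`, `weight(γ) = x_c^{|γ|}` term by term. Junk cases agree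
(no SAW: both sides `0`). -/
def SAWEndpointIdentity : Prop :=
  ∀ (Ω S : Set ℂ) (δ : ℝ) (a b : Site 2), Bornology.IsBounded Ω → 0 < δ → a ≠ b →
    ((SAW.law Ω δ a b).map (fun γ => γ.curve)) (CurveClass.rangeSubset (closure S)) =
      ENNReal.ofReal (Rδ (0 : ℝ) 0 SAW.criticalFugacity Ω S δ a b)

/-- **S2 · Determinantal** (the dictionary at the anchor — adjugate path expansion; provable now, M).
On every finite piece `(H, Λ)` of `ℤ²`, at loop fugacity `-2` and dimer fugacity `-1` the dressed SAW
is a DETERMINANT: `Z(H,Λ;{a,b}) = adj(1 - xA)_{ab}` and `Z(H,Λ;∅) = det(1 - xA)` (`A` = adjacency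
matrix of `H|_Λ`). Permutation expansion: a `k`-cycle along edges contributes `-x^k` in each of its
two orientations (`n = -2`), a transposition along an edge `-x²` (`t = -1`); the two-leg version is
Cramer/chronological loop-erasure, `adj(1-xA)_{ab} = Σ_{paths p : a → b} x^{|p|} det((1-xA)|_{Λ∖p})`.
Verified in exact arithmetic on the `3×3`, `3×2`, `4×3`, `3×4` grids by the ideator and two triagers. -/
def Determinantal : Prop :=
  ∀ (H : SimpleGraph (Site 2)) [H.LocallyFinite], H ≤ zdGraph 2 →
    ∀ (Λ : Finset (Site 2)) (x : ℝ) (a b : Site 2) (ha : a ∈ Λ) (hb : b ∈ Λ), a ≠ b →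
      dimerPF (-2 : ℝ) (-1) x H Λ ({a} ∆ {b}) =
          ((1 : Matrix Λ Λ ℝ) - x • adjMat H Λ).adjugate ⟨a, ha⟩ ⟨b, hb⟩ ∧
        dimerPF (-2 : ℝ) (-1) x H Λ ∅ = ((1 : Matrix Λ Λ ℝ) - x • adjMat H Λ).det

/-- **S3 · ExcursionRatio** (the anchor in potential-theory language; provable now, M–L). For hull
data as in the crux, the ratio of SRW Green's functions between `a_δ` and `b_δ` — walk on `Ω_δ`
killed when it uses an edge whose segment leaves `closure D'`, over walk on `Ω_δ` — tends to
`d = Φ'_A(0)`: the Brownian EXCURSION from `a` to `b` in `D` stays in `closure D'` with probability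
`H_{D'}(a,b)/H_D(a,b) = Φ'_A(0)^1` (restriction exponent `1`; chordal normalisation of `φ` and
`Φ(z)/z → 1` at `∞` make the boundary Poisson-kernel factors at `a` and `b` cancel). Lattice proof:
strong Markov at the first exit of `B(a, ε/2)` and last entrance of `B(b, ε/2)`, inside which the two
graphs COINCIDE (ball agreement), then ratio limits of discrete harmonic functions (Kozdron–Lawler). -/
def ExcursionRatio : Prop :=
  ∀ (D D' : DobrushinDomain) (a b : ℝ → Site 2), SAW.IsEndpointApprox D a b →
    D'.carrier ⊆ D.carrier → D'.pt 0 = D.pt 0 → D'.pt 1 = D.pt 1 →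
    (∃ ε : ℝ, 0 < ε ∧ D'.carrier ∩ Metric.ball (D.pt 0) ε = D.carrier ∩ Metric.ball (D.pt 0) ε ∧
      D'.carrier ∩ Metric.ball (D.pt 1) ε = D.carrier ∩ Metric.ball (D.pt 1) ε) →
    ∀ (φ : ConformalEquiv UpperHalfPlane.upperHalfPlaneSet D.carrier), D.IsChordalUniformizing φ →
    ∀ (A : Set ℂ), A = closure (UpperHalfPlane.upperHalfPlaneSet \
      {z | z ∈ UpperHalfPlane.upperHalfPlaneSet ∧ φ z ∈ D'.carrier}) →
    ∀ (Φ : ConformalEquiv (UpperHalfPlane.upperHalfPlaneSet \ A) UpperHalfPlane.upperHalfPlaneSet)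
      (d : ℝ), IsRestrictionMap A Φ → HasRestrictionDeriv A Φ d →
    Tendsto (fun δ => greenRatio D.carrier D'.carrier δ (a δ) (b δ)) (𝓝[>] 0) (𝓝 d)

/-- **S3a · GreenRatioDecomposition** (lead c1 reshape of S3; finite lattice identity, provable now, M).
THE TWO-SIDED FIRST-EXIT / LAST-ENTRANCE DECOMPOSITION. Fix the volume `Λ = meshDomainFinset Ω δ`, the
domain walk `H = Ω_δ` and the confined walk `H^c = confinedGraph Ω S δ ≤ H`, with ball agreement
`S ∩ B(p, ε) = Ω ∩ B(p, ε)` at the two centres `p = p_a, p_b`. Every walk `a → b` of `H` with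
`δa ∈ B(p_a, r)`, `δb ∈ B(p_b, r)` splits uniquely as (first exit from the lattice ball at `p_a`) ++
(middle) ++ (last entrance into the lattice ball at `p_b`); the two outer pieces live inside
`B(p_·, r + δ) ⊆ B(p_·, ε)` where `H` and `H^c` have THE SAME edges (`confinedGraph_adj_iff_of_ball`),
so with the exit kernels `E_a(z) = Σ_{u ∈ B_a, u ∼ z} G_{H|B_a}(a,u)/4`, `E_b(y)` (resolvent identity
`greenEntry_sub_greenEntry_eq_sum` for `H|_{B} ≤ H`, symmetry `greenEntry_comm`):
`G_H(a,b) = Σ_{z,y} E_a(z) E_b(y) G_H(z,y)` and `G_{H^c}(a,b) = Σ_{z,y} E_a(z) E_b(y) G_{H^c}(z,y)` with the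
SAME nonnegative weights, `z`, `y` ranging over the two lattice exit spheres
`r ≤ |δz − p_a| < r + δ`, `r ≤ |δy − p_b| < r + δ`. Hence `greenRatio Ω S δ a b` is a convex combination
of the INTERIOR ratios `G_{H^c}(z,y)/G_H(z,y)` over sphere pairs with `G_H(z,y) > 0`: any two-sided bound
`m ≤ · ≤ M` there transfers to the ratio. This removes every dependence on the endpoint approximation
(the walk from `a_δ`, however deep in a fjord, is only seen through where it first reaches distance `r`).
[cite: Lawler1991, §1.4–1.5 (last-exit / first-entrance decompositions of Green's functions)] -/
def GreenRatioDecomposition : Prop :=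
  ∀ (Ω S : Set ℂ) (pa pb : ℂ) (ε r δ : ℝ) (a b : Site 2) (m M : ℝ),
    Bornology.IsBounded Ω → 0 < δ → 0 < r → r + 2 * δ ≤ ε →
    S ∩ Metric.ball pa ε = Ω ∩ Metric.ball pa ε → S ∩ Metric.ball pb ε = Ω ∩ Metric.ball pb ε →
    2 * r + 2 * δ ≤ dist pa pb →
    dist (meshPoint δ a) pa < r → dist (meshPoint δ b) pb < r →
    0 < greenEntry (discreteDomainGraph Ω δ) (meshDomainFinset Ω δ) a b →
    (∀ z y : Site 2, r ≤ dist (meshPoint δ z) pa → dist (meshPoint δ z) pa < r + δ →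
      r ≤ dist (meshPoint δ y) pb → dist (meshPoint δ y) pb < r + δ →
      0 < greenEntry (discreteDomainGraph Ω δ) (meshDomainFinset Ω δ) z y →
      m ≤ greenEntry (confinedGraph Ω S δ) (meshDomainFinset Ω δ) z y /
          greenEntry (discreteDomainGraph Ω δ) (meshDomainFinset Ω δ) z y ∧
        greenEntry (confinedGraph Ω S δ) (meshDomainFinset Ω δ) z y /
          greenEntry (discreteDomainGraph Ω δ) (meshDomainFinset Ω δ) z y ≤ M) →
    m ≤ greenRatio Ω S δ a b ∧ greenRatio Ω S δ a b ≤ M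

/-- **S3b · SphereRatioLimit** (lead c1 reshape of S3; the lattice → continuum content, L–XL).
UNIFORM CONVERGENCE OF THE INTERIOR RATIO ON THE TWO SHRINKING SPHERES. For hull data as in the crux
(no endpoint approximation involved): for every `η > 0` there is `r₀ > 0` such that for every radius
`r ∈ (0, r₀)`, for all small `δ`, at EVERY pair `(z, y)` of the two lattice exit spheres of radius `r`
about the marked points with `G_{Ω_δ}(z,y) > 0`, the killed-SRW ratio `G^c(z,y)/G(z,y)` is within `η`
of `d = Φ'_A(0)`. Content: (i) continuum — the ratio of CONTINUUM Green's functions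
`G_{D'}(z,y)/G_D(z,y) = G_{ℍ∖A}(u,v)/G_ℍ(u,v)` (`u = φ⁻¹z`, `v = φ⁻¹y`) tends to `d` as `(z,y) → (a,b)`
in `D̄ × D̄` (landed `tendsto_greenHalfPlane_ratio` at `(u,v) → (0,∞)`, plus uniform continuity of
`φ⁻¹` on `closure D`, Carathéodory–Jordan: Euclidean-close to `a` ⇒ conformally close to `0`, fjords
included); (ii) lattice — `sup_{spheres} |G^c_δ/G_δ − G_{D'}/G_D| → 0` for each fixed small `r`: an
invariance principle for killed-SRW Green's-function RATIOS uniform up to the boundary `∂D` met by the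
spheres, i.e. interior convergence of discrete harmonic functions + a `δ`-uniform boundary Harnack
principle in the simply connected lattice domain `Ω_δ` (print: Kozdron–Lawler 2005 §3 for grid domains;
Chelkak 2016 (toolbox) §3 uniformly in simply connected discrete domains; NOT in the tree). The sphere
points near `∂D` cannot be discarded: in a fjord at `a` the exit distribution of `B(a,r)` from `a_δ`
may concentrate within `o(r)` of `∂D`. -/
def SphereRatioLimit : Prop :=
  ∀ (D D' : DobrushinDomain), D'.carrier ⊆ D.carrier → D'.pt 0 = D.pt 0 → D'.pt 1 = D.pt 1 →
    (∃ ε : ℝ, 0 < ε ∧ D'.carrier ∩ Metric.ball (D.pt 0) ε = D.carrier ∩ Metric.ball (D.pt 0) ε ∧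
      D'.carrier ∩ Metric.ball (D.pt 1) ε = D.carrier ∩ Metric.ball (D.pt 1) ε) →
    ∀ (φ : ConformalEquiv UpperHalfPlane.upperHalfPlaneSet D.carrier), D.IsChordalUniformizing φ →
    ∀ (A : Set ℂ), A = closure (UpperHalfPlane.upperHalfPlaneSet \
      {z | z ∈ UpperHalfPlane.upperHalfPlaneSet ∧ φ z ∈ D'.carrier}) →
    ∀ (Φ : ConformalEquiv (UpperHalfPlane.upperHalfPlaneSet \ A) UpperHalfPlane.upperHalfPlaneSet)
      (d : ℝ), IsRestrictionMap A Φ → HasRestrictionDeriv A Φ d →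
    ∀ η : ℝ, 0 < η → ∃ r₀ : ℝ, 0 < r₀ ∧ ∀ r ∈ Set.Ioo (0 : ℝ) r₀, ∀ᶠ δ in 𝓝[>] (0 : ℝ),
      ∀ z y : Site 2, r ≤ dist (meshPoint δ z) (D.pt 0) → dist (meshPoint δ z) (D.pt 0) < r + δ →
        r ≤ dist (meshPoint δ y) (D.pt 1) → dist (meshPoint δ y) (D.pt 1) < r + δ →
        0 < greenEntry (discreteDomainGraph D.carrier δ) (meshDomainFinset D.carrier δ) z y →
        |greenEntry (confinedGraph D.carrier D'.carrier δ) (meshDomainFinset D.carrier δ) z y /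
            greenEntry (discreteDomainGraph D.carrier δ) (meshDomainFinset D.carrier δ) z y - d| ≤ η

/-- **S3b-TOP · LatticeTopology** (worker reshape of S3b, provable now, M–L). Lattice topology of a
Jordan domain: two interior points `z*, y* ∈ D` are, for all small `δ`, approximated within any `s > 0`
by lattice points joined in `Ω_δ` inside the volume (`G_δ(u,v) > 0`): for small `δ` the largest mesh
component `meshDomain D δ` contains the lattice points near any compact part of `D` (a component cut
off from the main body sits behind a neck of `∂D` of width `< 2δ`, and by uniform continuity of the
inverse boundary parametrisation such necks only cut off pieces of diameter `o(1)`). [folklore] -/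
def LatticeTopology : Prop :=
  ∀ (D : DobrushinDomain) (zs ys : ℂ), zs ∈ D.carrier → ys ∈ D.carrier → ∀ s : ℝ, 0 < s →
    ∀ᶠ δ in 𝓝[>] (0 : ℝ), ∃ u v : Site 2, dist (meshPoint δ u) zs < s ∧ dist (meshPoint δ v) ys < s ∧
    0 < greenEntry (discreteDomainGraph D.carrier δ) (meshDomainFinset D.carrier δ) u v

/-- **S3b-BHP · RatioOscillation** (worker reshape of S3b; THE deep lattice input, L–XL). The
oscillation of `F_δ = G^c_δ/G_δ` over `B(a,r) × B(b,r)` tends to `0` with `r`, UNIFORMLY in small `δ`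
(pairs with positive denominators). This is the uniform discrete boundary Harnack principle of
Chelkak–Wan (EJP 26 (2021), arXiv:1903.08045, §3.2 Lemma 3.7 / Cor. 3.8: for positive discrete
harmonic `H₁, H₂` on a simply connected discrete domain with Dirichlet conditions off a boundary
neighbourhood, `(H₁(u)/H₂(u))/(H₁(v)/H₂(v)) ≤ (1+k^q)/(1−k^q)`, universal `k < 1`) applied at `a` and
at `b` to `G^c_δ(·,y), G_δ(·,y)` — harmonic for the SAME walk inside the agreement balls
(`confinedGraph_adj_iff_of_ball`) — resting on Chelkak's toolbox (Ann. Probab. 44 (2016)). Not in the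
tree; convention gap to watch when vendoring: the tree kills the walk on EDGES leaving `closure D`
(general `(V, E_int)` discrete domains, toolbox §2.2), print states induced subgraphs of `δℤ²`.
[cite: ChelkakWan2021, Lemma 3.7 and Corollary 3.8 (§3.2)] -/
def RatioOscillation : Prop :=
  ∀ (D D' : DobrushinDomain), D'.carrier ⊆ D.carrier → D'.pt 0 = D.pt 0 → D'.pt 1 = D.pt 1 →
    (∃ ε : ℝ, 0 < ε ∧ D'.carrier ∩ Metric.ball (D.pt 0) ε = D.carrier ∩ Metric.ball (D.pt 0) ε ∧
    D'.carrier ∩ Metric.ball (D.pt 1) ε = D.carrier ∩ Metric.ball (D.pt 1) ε) →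
    ∀ η : ℝ, 0 < η → ∃ r : ℝ, 0 < r ∧ ∀ᶠ δ in 𝓝[>] (0 : ℝ), ∀ z z' y y' : Site 2,
    dist (meshPoint δ z) (D.pt 0) < r → dist (meshPoint δ z') (D.pt 0) < r →
    dist (meshPoint δ y) (D.pt 1) < r → dist (meshPoint δ y') (D.pt 1) < r →
    0 < greenEntry (discreteDomainGraph D.carrier δ) (meshDomainFinset D.carrier δ) z y →
    0 < greenEntry (discreteDomainGraph D.carrier δ) (meshDomainFinset D.carrier δ) z' y' →
    |greenEntry (confinedGraph D.carrier D'.carrier δ) (meshDomainFinset D.carrier δ) z y /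
    greenEntry (discreteDomainGraph D.carrier δ) (meshDomainFinset D.carrier δ) z y -
    greenEntry (confinedGraph D.carrier D'.carrier δ) (meshDomainFinset D.carrier δ) z' y' /
    greenEntry (discreteDomainGraph D.carrier δ) (meshDomainFinset D.carrier δ) z' y'| ≤ η

/-- **S3b-INT · InteriorRatioLimit** (worker reshape of S3b; classical lattice → continuum input, L–XL).
At every pair of distinct interior reference points `z*, y* ∈ D'`, `F_δ(u,v) → ρ(z*,y*) =
G_{D'}(z*,y*)/G_D(z*,y*)` (written through `φ`, `Φ_A`: conformal invariance of the continuum Green's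
function) as `δu → z*`, `δv → y*`, `δ → 0`: interior convergence of discrete Green's functions under
Carathéodory approximation (Chelkak–Wan Prop. 3.2 / Cor. 3.3 = Chelkak–Smirnov, Adv. Math. 228 (2011),
Thm. 3.9) for `Ω_δ → D` and for the confined walk `→ D'`. Not in the tree (no discrete-to-continuum
harmonic convergence theorem yet; 2D potential-kernel asymptotics needed for the normalisation).
[cite: ChelkakWan2021, Proposition 3.2 and Corollary 3.3 (§3.1)] -/
def InteriorRatioLimit : Prop :=
  ∀ (D D' : DobrushinDomain), D'.carrier ⊆ D.carrier → D'.pt 0 = D.pt 0 → D'.pt 1 = D.pt 1 →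
    (∃ ε : ℝ, 0 < ε ∧ D'.carrier ∩ Metric.ball (D.pt 0) ε = D.carrier ∩ Metric.ball (D.pt 0) ε ∧
    D'.carrier ∩ Metric.ball (D.pt 1) ε = D.carrier ∩ Metric.ball (D.pt 1) ε) →
    ∀ (φ : ConformalEquiv UpperHalfPlane.upperHalfPlaneSet D.carrier), D.IsChordalUniformizing φ →
    ∀ (A : Set ℂ), A = closure (UpperHalfPlane.upperHalfPlaneSet \
    {z | z ∈ UpperHalfPlane.upperHalfPlaneSet ∧ φ z ∈ D'.carrier}) →
    ∀ (Φ : ConformalEquiv (UpperHalfPlane.upperHalfPlaneSet \ A) UpperHalfPlane.upperHalfPlaneSet),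
    IsRestrictionMap A Φ →
    ∀ zs ys : ℂ, zs ∈ D'.carrier → ys ∈ D'.carrier → zs ≠ ys →
    ∀ η : ℝ, 0 < η → ∃ s : ℝ, 0 < s ∧ ∀ᶠ δ in 𝓝[>] (0 : ℝ), ∀ u v : Site 2,
    dist (meshPoint δ u) zs < s → dist (meshPoint δ v) ys < s →
    0 < greenEntry (discreteDomainGraph D.carrier δ) (meshDomainFinset D.carrier δ) u v →
    |greenEntry (confinedGraph D.carrier D'.carrier δ) (meshDomainFinset D.carrier δ) u v /
    greenEntry (discreteDomainGraph D.carrier δ) (meshDomainFinset D.carrier δ) u v -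
    Real.log (‖Φ (φ.symm zs) - (starRingEnd ℂ) (Φ (φ.symm ys))‖ / ‖Φ (φ.symm zs) - Φ (φ.symm ys)‖) /
    Real.log (‖φ.symm zs - (starRingEnd ℂ) (φ.symm ys)‖ / ‖φ.symm zs - φ.symm ys‖)| ≤ η

/-- **S3b-UBHP · UniformBHP** (lead c1 reshape of BHP; THE deep lattice input, XL). Uniform discrete boundary
Harnack principle for the EDGE-killed `Ω_δ`-walk at a marked prime end, in multiplicative division-free form: for a
Dobrushin domain `D`, a marked point `p = D.pt i`, `R > 0` and `η > 0` there is `r > 0` such that for all small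
`δ`, any two nonnegative functions on `Λ = meshDomainFinset D δ` that are harmonic for the killed walk
(`P h = h`, `P = ¼·adjMat (discreteDomainGraph D δ) Λ`) at every vertex within `R` of `p` satisfy
`h₁(z) h₂(z') ≤ (1 + η) h₁(z') h₂(z)` at all vertices within `r` of `p`. Print (Chelkak–Wan 2021 Cor. 3.8, vendored
as `Literature.Probability.LatticeModels.ChelkakWan_uniformBoundaryHarnack`) covers SITE-killed induced domains and inner
balls; the `(V, E_int)` extension and the Euclidean-ball form are the unprinted gap (see the reduction file
`Theorems/SAWLoopFugacityFlowAvoidanceLimitRatioOscillationReduction.lean`). [cite: ChelkakWan2021, Corollary 3.8 (§3.2)] -/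
def UniformBHP : Prop :=
  ∀ (D : DobrushinDomain) (i : Fin 2) (R : ℝ), 0 < R → ∀ η : ℝ, 0 < η → ∃ r : ℝ, 0 < r ∧
    ∀ᶠ δ in 𝓝[>] (0 : ℝ), ∀ h₁ h₂ : ↥(meshDomainFinset D.carrier δ) → ℝ,
      (∀ x, 0 ≤ h₁ x) → (∀ x, 0 ≤ h₂ x) →
      (∀ x : ↥(meshDomainFinset D.carrier δ), dist (meshPoint δ x) (D.pt i) < R →
        Matrix.mulVec ((4 : ℝ)⁻¹ • adjMat (discreteDomainGraph D.carrier δ)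
          (meshDomainFinset D.carrier δ)) h₁ x = h₁ x) →
      (∀ x : ↥(meshDomainFinset D.carrier δ), dist (meshPoint δ x) (D.pt i) < R →
        Matrix.mulVec ((4 : ℝ)⁻¹ • adjMat (discreteDomainGraph D.carrier δ)
          (meshDomainFinset D.carrier δ)) h₂ x = h₂ x) →
      ∀ z z' : ↥(meshDomainFinset D.carrier δ), dist (meshPoint δ z) (D.pt i) < r →
        dist (meshPoint δ z') (D.pt i) < r → h₁ z * h₂ z' ≤ (1 + η) * (h₁ z' * h₂ z)

/-- **S3b-UBHP-T · LatticeLocalConnectivity** (lead c4 reshape of UBHP; provable now — PROVED, v11). Lattice uniform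
local connectivity of a Jordan domain at a boundary point: for `ρ > 0` there is `r > 0` such that, for all small `δ`, any two
vertices of `Ω_δ = meshDomain D δ` within `r` of `p` are joined by an `Ω_δ`-walk staying within `ρ` of `p` (Jordan ⇒ one prime
end at `p`; lattice version via a local Jordan neighbourhood in the Carathéodory chart, the macroscopic-diameter criterion for mesh
components and the bulk theorem). It is what makes the Euclidean balls of `UniformBHP` harmless (`Λ ∩ B(p,r) ⊆ S_q`). [folklore] -/
def LatticeLocalConnectivity : Prop :=
  ∀ (D : JordanDomain) (p : ℂ), p ∈ frontier D.carrier → ∀ ρ : ℝ, 0 < ρ → ∃ r : ℝ, 0 < r ∧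
    ∀ᶠ δ in 𝓝[>] (0 : ℝ), ∀ u v : Site 2, u ∈ meshDomain D.carrier δ → v ∈ meshDomain D.carrier δ →
      dist (meshPoint δ u) p < r → dist (meshPoint δ v) p < r →
      ∃ w : (discreteDomainGraph D.carrier δ).Walk u v,
        ∀ z ∈ w.support, z ∈ meshDomain D.carrier δ ∧ dist (meshPoint δ z) p < ρ

/-- **S3b-UBHP-CR · GermCrossRatio** (lead c5 reshape of (CR), v12; THE analytic kernel, XL — Chelkak-toolbox strength;
verbatim the hypothesis `hcore` of `Literature.Probability.LatticeModels.uniformBHP_of_crossRatio`). For every Jordan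
domain `D` and boundary point `b` there are a scale ratio `K > 1`, a constant `C ≥ 1` and a top scale `s₀ > 0` such that
for all scales `s < s' = K s < s₀`, every base point `g ∈ D ∩ box b s` (open sup-norm box of radius `s`), every far point
`o ∈ D` off `closedBox b s'`, with two points of each box boundary off `D` (`TwoOff`, automatic for small boxes at a
boundary point: `twoOff_boxJD`), eventually as `δ → 0+`: for all exits `u, v` of the inner lattice germ region
`Θ_δ(s) = germSites D b s g o δ` (the sites of `Ω_δ` in the germ region `U(s)` = `g`'s side of the gate of `box b s`
facing `o`; exits `germExits` = sites outside reached by a kept edge, all within `δ` of the gate) and all exits `x, y`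
of the outer one `Θ_δ(s')`, the exit kernels `P = killedPoisson (Ω_δ) Θ_δ(s')` (probability that the edge-killed walk
from the first argument leaves `Θ_δ(s')` alive, through the second) satisfy `P(u,x) P(v,y) ≤ C · P(v,x) P(u,y)`.
This is Chelkak–Wan 2021, Prop. 3.6 (the input of Lemma 3.7) for the EDGE-killed walk: by the entrance
decomposition (`KilledWalkEntranceDecomposition.crossRatio_of_annulus`) it is the rank-one factorisation of the
crossing kernel of the lattice quadrilateral between the two gates (inner gate, outer gate, two lateral arcs of
`∂D`; Euclidean separation of the square rings ⇒ extremal length `≥ c₀(K)`), i.e. Chelkak 2016 §3 (Prop. 3.1,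
Lemma 3.2, Prop. 3.3: hub ball + separating walls + weak Beurling) for `(V, E_int)` subdomains of `ℤ²`.
Not in the tree. [cite: ChelkakWan2021, Proposition 3.6; Chelkak2016, Prop. 3.1, Prop. 3.3, Thm. 3.5] -/
def GermCrossRatio : Prop :=
  ∀ (D : JordanDomain), ∀ b ∈ frontier D.carrier, ∃ K C s₀ : ℝ, 1 < K ∧ 1 ≤ C ∧ 0 < s₀ ∧
    ∀ (s s' : ℝ) (hs : 0 < s) (hs' : 0 < s'), s' = K * s → s' < s₀ →
    ∀ (g o : ℂ), g ∈ D.carrier ∩ Literature.Topology.PlaneTopology.box b s → o ∈ D.carrier →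
    o ∉ closedBox b s' → TwoOff D (boxJD b hs) → TwoOff D (boxJD b hs') →
    ∀ᶠ δ in 𝓝[>] (0 : ℝ),
      ∀ u ∈ germExits D b hs g o δ, ∀ v ∈ germExits D b hs g o δ,
      ∀ x ∈ germExits D b hs' g o δ, ∀ y ∈ germExits D b hs' g o δ,
        killedPoisson (discreteDomainGraph D.carrier δ) (germSites D b hs' g o δ) u x *
            killedPoisson (discreteDomainGraph D.carrier δ) (germSites D b hs' g o δ) v y ≤
          C * (killedPoisson (discreteDomainGraph D.carrier δ) (germSites D b hs' g o δ) v x *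
            killedPoisson (discreteDomainGraph D.carrier δ) (germSites D b hs' g o δ) u y)

/-- **S3b-UBHP-TS · GermTwoSided** (lead c6 reshape, v13 — the hub factorisation BEHIND `GermCrossRatio`; XL, the one
analytic debt). For every Jordan domain `D` and boundary point `b` there are `K > 1`, constants `0 < c₀ ≤ C₀` and a top
scale `s₀ > 0` such that for all scales `s < s' = K s < s₀` and all admissible base/far points `g, o`, eventually as
`δ → 0+`, the exit kernel `P = killedPoisson (Ω_δ) Θ_δ(s')` restricted to (inner exits `E_δ(s)`) × (outer exits `E_δ(s')`)
is TWO-SIDEDLY comparable to a product: `c₀ f(u) g(x) ≤ P(u,x) ≤ C₀ f(u) g(x)` for some nonnegative `f, g` (which may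
depend on `δ` and on all the data; only `c₀, C₀` are uniform). This is Chelkak's factorisation of the exit kernel through
a hub (Chelkak 2016, Prop. 3.1 + Prop. 3.3: `f(u) = P_u[hit the hub box]`, `g(x) = max over the hub of P(·,x)`; lower
bound = strong Markov + Harnack on the clean hub, upper bound = separating walls + wall-ball bounds + shield/Beurling at
the landings), for the EDGE-killed walk in the lattice germ regions; `GermCrossRatio` follows with `C = (C₀/c₀)²`
(`germCrossRatio_of_twoSided`, the algebra of the landed `Anchor.crossRatio_le_of_twoSided`). Blueprint of the proof:
`Cruxes/AvoidanceLimit/NOTES.md` §"hcore blueprint (lead c6)". Not in the tree.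
[cite: Chelkak2016, Prop. 3.1, Prop. 3.3, Thm. 3.5; ChelkakWan2021, Proposition 3.6] -/
def GermTwoSided : Prop :=
  ∀ (D : JordanDomain), ∀ b ∈ frontier D.carrier, ∃ K c₀ C₀ s₀ : ℝ, 1 < K ∧ 0 < c₀ ∧ c₀ ≤ C₀ ∧ 0 < s₀ ∧
    ∀ (s s' : ℝ) (hs : 0 < s) (hs' : 0 < s'), s' = K * s → s' < s₀ →
    ∀ (g o : ℂ), g ∈ D.carrier ∩ Literature.Topology.PlaneTopology.box b s → o ∈ D.carrier →
    o ∉ closedBox b s' → TwoOff D (boxJD b hs) → TwoOff D (boxJD b hs') →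
    ∀ᶠ δ in 𝓝[>] (0 : ℝ), ∃ f gx : Site 2 → ℝ, (∀ u, 0 ≤ f u) ∧ (∀ x, 0 ≤ gx x) ∧
      ∀ u ∈ germExits D b hs g o δ, ∀ x ∈ germExits D b hs' g o δ,
        c₀ * (f u * gx x) ≤ killedPoisson (discreteDomainGraph D.carrier δ) (germSites D b hs' g o δ) u x ∧
          killedPoisson (discreteDomainGraph D.carrier δ) (germSites D b hs' g o δ) u x ≤ C₀ * (f u * gx x)

/-- **Glue (v13): a two-sided factorisation bounds every cross-ratio** — `GermTwoSided → GermCrossRatio` with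
`C = (C₀/c₀)²`: both `P(u,x)P(v,y)` and `P(v,x)P(u,y)` are compared with `f(u)f(v)g(x)g(y)`, from above with `C₀²` and
from below with `c₀²` (the algebra of `Anchor.crossRatio_le_of_twoSided`, here with the quantifiers restricted to the
exit sets). [cite: Chelkak2016, Theorem 3.5] -/
theorem germCrossRatio_of_twoSided (h : GermTwoSided) : GermCrossRatio := by
  intro D b hb
  obtain ⟨K, c₀, C₀, s₀, hK, hc₀, hcC, hs₀, H⟩ := h D b hb
  have hratio : 1 ≤ C₀ / c₀ := by rwa [le_div_iff₀ hc₀, one_mul]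
  refine ⟨K, (C₀ / c₀) ^ 2, s₀, hK, one_le_pow₀ hratio, hs₀, ?_⟩
  intro s s' hs hs' hss' hs₀' g o hg ho hoc h2 h2'
  filter_upwards [H s s' hs hs' hss' hs₀' g o hg ho hoc h2 h2'] with δ hδ
  obtain ⟨f, gx, hf, hgx, hfg⟩ := hδ
  intro u hu v hv x hx y hy
  have hP0 : ∀ w ∈ germExits D b hs g o δ, ∀ z ∈ germExits D b hs' g o δ,
      0 ≤ killedPoisson (discreteDomainGraph D.carrier δ) (germSites D b hs' g o δ) w z := fun w hw z hz =>
    le_trans (mul_nonneg hc₀.le (mul_nonneg (hf w) (hgx z))) (hfg w hw z hz).1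
  calc killedPoisson (discreteDomainGraph D.carrier δ) (germSites D b hs' g o δ) u x *
        killedPoisson (discreteDomainGraph D.carrier δ) (germSites D b hs' g o δ) v y
      ≤ (C₀ * (f u * gx x)) * (C₀ * (f v * gx y)) :=
        mul_le_mul (hfg u hu x hx).2 (hfg v hv y hy).2 (hP0 v hv y hy)
          (le_trans (hP0 u hu x hx) (hfg u hu x hx).2)
    _ = (C₀ / c₀) ^ 2 * ((c₀ * (f v * gx x)) * (c₀ * (f u * gx y))) := by
        rw [div_pow]
        field_simp
    _ ≤ (C₀ / c₀) ^ 2 * (killedPoisson (discreteDomainGraph D.carrier δ) (germSites D b hs' g o δ) v x *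
          killedPoisson (discreteDomainGraph D.carrier δ) (germSites D b hs' g o δ) u y) :=
        mul_le_mul_of_nonneg_left
          (mul_le_mul (hfg v hv x hx).1 (hfg u hu y hy).1 (mul_nonneg hc₀.le (mul_nonneg (hf u) (hgx y)))
            (hP0 v hv x hx))
          (sq_nonneg _)

/-- **S3b-UBHP-UP · GermUpper** (lead c7 reshape, v14 — the factorisation UPPER BOUND at a given hub; XL, THE analytic debt).
There are universal `Λu > 1`, `C₀ ≥ 1` such that for every Jordan `D`, `b ∈ ∂D`, ring parameter `Λ' ≥ Λu`, scales
`Λ'³ s ≤ s'`, admissible `g, o`, nested germ arcs `σ' < θ₁ < θ₂ < τ'`, eventually as `δ → 0`: for EVERY hub datum — a site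
`z ∈ Θ' ∖ Θ(s)` in the ring `Λ' s ≤ |δz−b|∞`, `Λ'|δz−b|∞ ≤ s'`, with both lateral side potentials `≥ 1/10`, and a box scale
`k ≥ 1` at the Whitney scale (`100kδ ≤ dist(δz,∂D) ≤ 800kδ`) whose frame `mW z (2k)` lies in `Θ'` with all lattice edges
kept — and for all inner exits `u` and outer exits `x`:
`P(u,x) ≤ C₀ · hitProb_{Θ'}(mB z k)(u) · P(z,x)`, `P = killedPoisson Ω^δ Θ'`. This is Chelkak 2016 Prop. 3.3 (walls from the
hub to the two laterals inside the truncated region `Ω_{R,r}`, fat part by Harnack = `fatSite_good`, separation =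
`walls_separate`, assembly = `killedPoisson_le_of_goodSeparator`; the open kernel is the goodness / traffic bound of the wall
TAILS in the protected one-arc zone — crux NOTES.md §"hcore after lead c7" (K)). Hub data of exactly this shape exist
eventually (`germHub_ge` + `exists_clean_hubBox`, landed), and the LOWER bound with `c₀ = maneuverConst/2` is `hub_twoSided`
(landed), whence `GermTwoSided` (`germTwoSided_of_upper`). Not in the tree. [cite: Chelkak2016, Proposition 3.3] -/
def GermUpper : Prop :=
  ∃ Λu C₀ : ℝ, 1 < Λu ∧ 1 ≤ C₀ ∧ ∀ (D : JordanDomain), ∀ b ∈ frontier D.carrier, ∀ (Λ' : ℝ), Λu ≤ Λ' →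
    ∀ (s s' : ℝ) (hs : 0 < s) (hs' : 0 < s'), Λ' ^ 3 * s ≤ s' →
    ∀ (g o : ℂ), TwoOff D (boxJD b hs) → TwoOff D (boxJD b hs') →
      g ∈ D.carrier ∩ Literature.Topology.PlaneTopology.box b s → o ∈ D.carrier → o ∉ closedBox b s' →
    ∀ (σ' θ₁ θ₂ τ' : ℝ), σ' < θ₁ → θ₁ < θ₂ → θ₂ < τ' → τ' < σ' + 1 →
      frontier (germRegion D b hs' g o) =
        gateArc D (boxJD b hs') (germGateParam D b hs' g o) ∪ D.boundary '' Set.Icc σ' τ' →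
      frontier (germRegion D b hs g o) =
        gateArc D (boxJD b hs) (germGateParam D b hs g o) ∪ D.boundary '' Set.Icc θ₁ θ₂ →
      ({D.boundary θ₁, D.boundary θ₂} : Set ℂ) =
        {(boxJD b hs).boundary (gateLo D (boxJD b hs) (germGateParam D b hs g o)),
         (boxJD b hs).boundary (gateHi D (boxJD b hs) (germGateParam D b hs g o))} →
      ({D.boundary σ', D.boundary τ'} : Set ℂ) =
        {(boxJD b hs').boundary (gateLo D (boxJD b hs') (germGateParam D b hs' g o)),
         (boxJD b hs').boundary (gateHi D (boxJD b hs') (germGateParam D b hs' g o))} →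
    ∀ᶠ δ in 𝓝[>] (0 : ℝ), ∀ (z : Site 2) (k : ℕ), z ∈ germSites D b hs' g o δ → z ∉ germSites D b hs g o δ →
      Λ' * s ≤ max |(meshPoint δ z).re - b.re| |(meshPoint δ z).im - b.im| →
      Λ' * max |(meshPoint δ z).re - b.re| |(meshPoint δ z).im - b.im| ≤ s' →
      1 / 10 ≤ killedPotential (discreteDomainGraph D.carrier δ) (germSites D b hs' g o δ)
        (sideSrc (discreteDomainGraph D.carrier δ) D.carrier δ (D.boundary '' Set.Icc σ' θ₁)) z →
      1 / 10 ≤ killedPotential (discreteDomainGraph D.carrier δ) (germSites D b hs' g o δ)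
        (sideSrc (discreteDomainGraph D.carrier δ) D.carrier δ (D.boundary '' Set.Icc θ₂ τ')) z →
      0 < k → 100 * (k : ℝ) * δ ≤ Metric.infDist (meshPoint δ z) (frontier D.carrier) →
      Metric.infDist (meshPoint δ z) (frontier D.carrier) ≤ 800 * (k : ℝ) * δ →
      (∀ w ∈ mW z (2 * k), w ∈ germSites D b hs' g o δ ∧
        ∀ e : SRW.Dir 2, (discreteDomainGraph D.carrier δ).Adj w (w + SRW.stepVec e)) →
      ∀ u ∈ germExits D b hs g o δ, ∀ x ∈ germExits D b hs' g o δ,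
        killedPoisson (discreteDomainGraph D.carrier δ) (germSites D b hs' g o δ) u x ≤
          C₀ * hitProb (discreteDomainGraph D.carrier δ) (germSites D b hs' g o δ) (mB z k) u *
            killedPoisson (discreteDomainGraph D.carrier δ) (germSites D b hs' g o δ) z x

/-- **The clean hub frame lies in the outer germ region** (glue for v14): if `z ∈ Θ'` sits in the ring
`4·|δz − b|∞ ≤ s'`… precisely `Λ'|δz−b|∞ ≤ s'` with `Λ' ≥ 4`, then every mesh-domain site within `dist(δz,∂D) − 2δ` of `δz`
is a site of `Θ'`: the open ball `B(δz, dist(δz,∂D))` lies in `D` (`ball_infDist_frontier_subset_of_isOpen`), inside the open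
box of radius `s'` about `b` (so off the outer gate, which lies on that square), is preconnected and contains `δz ∈ U'`, hence
lies in the germ region `U'` (`subset_gateSide_of_isPreconnected`). [folklore] -/
theorem mem_germSites_of_dist_le {D : JordanDomain} {b : ℂ} {s' : ℝ} {hs' : 0 < s'} {g o : ℂ} {δ Λ' : ℝ}
    (hΛ' : 4 ≤ Λ') (hb : b ∈ frontier D.carrier) {z w : Site 2} (hz : z ∈ germSites D b hs' g o δ)
    (hring : Λ' * max |(meshPoint δ z).re - b.re| |(meshPoint δ z).im - b.im| ≤ s')
    (hw : w ∈ meshDomain D.carrier δ)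
    (hdist : dist (meshPoint δ w) (meshPoint δ z) ≤ Metric.infDist (meshPoint δ z) (frontier D.carrier) - 2 * δ)
    (hδ : 0 < δ) : w ∈ germSites D b hs' g o δ := by
  set p := meshPoint δ z with hp
  set d := Metric.infDist p (frontier D.carrier) with hd
  set M := max |p.re - b.re| |p.im - b.im| with hM
  have hzU : p ∈ germRegion D b hs' g o := hz.2
  have hzD : p ∈ D.carrier := germRegion_subset_carrier hzU
  -- the ball `B(p, d)` lies in `D`
  have hballD : Metric.ball p d ⊆ D.carrier :=
    Theorems.AvoidanceLimit.Anchor.ball_infDist_frontier_subset_of_isOpen D.isOpen hzD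
  -- `d ≤ dist p b ≤ 2M`
  have hdb : d ≤ dist p b := Metric.infDist_le_dist_of_mem hb
  have hM0 : |p.re - b.re| ≤ M := le_max_left _ _
  have hM1 : |p.im - b.im| ≤ M := le_max_right _ _
  have hpb : dist p b ≤ 2 * M := by
    rw [Complex.dist_eq]
    calc ‖p - b‖ ≤ |(p - b).re| + |(p - b).im| := Complex.norm_le_abs_re_add_abs_im _
      _ ≤ 2 * M := by rw [Complex.sub_re, Complex.sub_im]; linarith
  have hMpos_or : 0 ≤ M := le_trans (abs_nonneg _) hM0
  have hMs : 4 * M ≤ s' := le_trans (mul_le_mul_of_nonneg_right hΛ' hMpos_or) hring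
  -- the ball misses the outer gate (it lies in the open box of radius `s'`)
  have hballbox : Metric.ball p d ⊆ Literature.Topology.PlaneTopology.box b s' := by
    intro q hq
    rw [Metric.mem_ball, Complex.dist_eq] at hq
    have h0 : |(q - p).re| ≤ ‖q - p‖ := Complex.abs_re_le_norm _
    have h1 : |(q - p).im| ≤ ‖q - p‖ := Complex.abs_im_le_norm _
    rw [Complex.sub_re] at h0
    rw [Complex.sub_im] at h1
    rw [mem_box_iff_abs]
    have hq0 : |q.re - b.re| ≤ |q.re - p.re| + |p.re - b.re| := abs_sub_le _ _ _
    have hq1 : |q.im - b.im| ≤ |q.im - p.im| + |p.im - b.im| := abs_sub_le _ _ _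
    constructor <;> linarith
  have hballgate : Metric.ball p d ⊆ D.carrier \ germGate D b hs' g o := by
    intro q hq
    refine ⟨hballD hq, fun hqg => ?_⟩
    exact (germGate_subset_square hqg).2 (hballbox hq)
  have hballU : Metric.ball p d ⊆ germRegion D b hs' g o := by
    have hmeet : (Metric.ball p d ∩ germRegion D b hs' g o).Nonempty := by
      refine ⟨p, Metric.mem_ball_self ?_, hzU⟩
      have : (0 : ℝ) ≤ dist (meshPoint δ w) p := dist_nonneg
      linarith
    exact subset_gateSide_of_isPreconnected (convex_ball p d).isPreconnected hballgate hmeet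
  refine ⟨hw, hballU ?_⟩
  rw [Metric.mem_ball]
  linarith

/-- **Glue (v14): the two-sided factorisation from the upper bound at the hub** — `GermUpper → GermTwoSided` with
`K = Λ'³`, `c₀ = maneuverConst/2` (`hub_twoSided` on the clean hub frame of `exists_clean_hubBox` at the two-sided site of
`germHub_ge`; nested arcs from `exists_nested_germArcs`), `f = hitProb_{Θ'}(mB z k)`, `g = P(z,·)`.
[cite: Chelkak2016, Proposition 3.1 and Proposition 3.3] -/
theorem germTwoSided_of_upper (hU : GermUpper) : GermTwoSided := by
  intro D b hb
  obtain ⟨Λh, hΛh, hHub⟩ := Theorems.AvoidanceLimit.Anchor.germHub_ge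
  obtain ⟨Λu, C₀, hΛu, hC₀, hUp⟩ := hU
  set Λ' : ℝ := max (max Λh Λu) 4 with hΛ'
  have hΛ'h : Λh ≤ Λ' := (le_max_left _ _).trans (le_max_left _ _)
  have hΛ'u : Λu ≤ Λ' := (le_max_right _ _).trans (le_max_left _ _)
  have hΛ'4 : (4 : ℝ) ≤ Λ' := le_max_right _ _
  have hK1 : (1 : ℝ) < Λ' ^ 3 := by
    have : (1 : ℝ) < Λ' := by linarith
    exact one_lt_pow₀ this (by norm_num)
  refine ⟨Λ' ^ 3, maneuverConst / 2, C₀, 1, hK1, by linarith [maneuverConst_pos], ?_, one_pos, ?_⟩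
  · linarith [maneuverConst_le_one]
  intro s s' hs hs' hK _hs₀ g o hg ho hoc h2 h2'
  have hss' : s < s' := by rw [hK]; exact lt_mul_left hs hK1
  obtain ⟨σ', θ₁, θ₂, τ', hσθ, hθθ, hθτ, hτσ, hfU', hfU, hends, hends'⟩ :=
    Theorems.AvoidanceLimit.Anchor.exists_nested_germArcs D b s s' hs hs' hss' g o h2 h2' hg ho hoc
  have hK' : Λ' ^ 3 * s ≤ s' := by rw [hK]
  obtain ⟨ρ, hρ, hev⟩ := hHub Λ' hΛ'h D b hb s s' hs hs' hK' g o h2 h2' hg ho hoc σ' θ₁ θ₂ τ' hσθ hθθ hθτ hτσ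
    hfU' hfU hends hends'
  have hevU := hUp D b hb Λ' hΛ'u s s' hs hs' hK' g o h2 h2' hg ho hoc σ' θ₁ θ₂ τ' hσθ hθθ hθτ hτσ hfU' hfU hends hends'
  have hδρ : ∀ᶠ δ in 𝓝[>] (0 : ℝ), δ < ρ / 400 :=
    (eventually_lt_nhds (show (0 : ℝ) < ρ / 400 by positivity)).filter_mono nhdsWithin_le_nhds
  have hδpos : ∀ᶠ δ in 𝓝[>] (0 : ℝ), 0 < δ := eventually_mem_nhdsWithin
  filter_upwards [hev, hevU, hδρ, hδpos] with δ hzex hUδ hδρ' hδ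
  obtain ⟨z, hzΘ, hzs, hr1, hr2, hρz, hT, hB⟩ := hzex
  have h400 : 400 * δ ≤ Metric.infDist (meshPoint δ z) (frontier D.carrier) := by linarith
  obtain ⟨k, hk, hk1, hk2, hframe⟩ :=
    Theorems.AvoidanceLimit.Anchor.exists_clean_hubBox D δ hδ z (germSites_subset_meshDomain hzΘ) h400
  set Gr := discreteDomainGraph D.carrier δ with hGr
  set Θ' := germSites D b hs' g o δ with hΘ'
  have hΘfin : Θ'.Finite := germSites_finite hδ
  have hframeΘ : ∀ w ∈ mW z (2 * k), w ∈ Θ' ∧ ∀ e : SRW.Dir 2, Gr.Adj w (w + SRW.stepVec e) := fun w hw =>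
    ⟨mem_germSites_of_dist_le hΛ'4 hb hzΘ hr2 (hframe w hw).1 (hframe w hw).2.1 hδ, (hframe w hw).2.2⟩
  have htwo := Theorems.AvoidanceLimit.Anchor.hub_twoSided Gr Θ' hΘfin z k hk (fun w hw => (hframeΘ w hw).1)
    (fun w hw => (hframeΘ w hw).2)
  refine ⟨hitProb Gr Θ' (mB z k), fun x => killedPoisson Gr Θ' z x, fun u => hitProb_nonneg hΘfin u,
    fun x => killedPoisson_nonneg hΘfin z x, ?_⟩
  intro u hu x hx
  refine ⟨?_, ?_⟩
  · have h := (htwo x).1 u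
    simpa only [mul_assoc] using h
  · have h := hUδ z k hzΘ hzs hr1 hr2 hT hB hk hk1 hk2 hframeΘ u hu x hx
    simpa only [mul_assoc] using h

/-- **S3b-GC · GreenConvergence** (lead c1 reshape of INT; classical lattice → continuum input, L). Interior
convergence of the Green's function of the CONFINED walk (simple random walk of `Ω_δ(D)` killed when its edge leaves
`closure D'`): for some constant `c > 0` (its value `2/π` is immaterial), all Jordan `D' ⊆ D`, every conformal
`ψ : ℍ → D'`, distinct `z*, y* ∈ D'` and `η > 0` there is `s > 0` such that for all small `δ` and all lattice
`u, v` within `s` of `z*, y*`: `|G^c_δ(u,v) − c·G_ℍ(ψ⁻¹z*, ψ⁻¹y*)| ≤ η`. Print: Chelkak–Wan 2021 Cor. 3.3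
(Chelkak–Smirnov 2011 Thm. 3.9), vendored as `Literature.Probability.LatticeModels.killedGreen_tendsto_of_kernelConvergence`
for induced (site-killed) simply connected lattice domains; lead c2 reduces GC to that printed statement by
sandwiching the edge-killed confined walk between the site-killed walks of two hole-free induced approximants of `D'`.
[cite: ChelkakWan2021, Proposition 3.2 and Corollary 3.3 (§3.1)] -/
def GreenConvergence : Prop :=
  ∃ c : ℝ, 0 < c ∧ ∀ (D D' : JordanDomain), D'.carrier ⊆ D.carrier →
    ∀ (ψ : ConformalEquiv UpperHalfPlane.upperHalfPlaneSet D'.carrier),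
    ∀ zs ys : ℂ, zs ∈ D'.carrier → ys ∈ D'.carrier → zs ≠ ys →
    ∀ η : ℝ, 0 < η → ∃ s : ℝ, 0 < s ∧ ∀ᶠ δ in 𝓝[>] (0 : ℝ), ∀ u v : Site 2,
      dist (meshPoint δ u) zs < s → dist (meshPoint δ v) ys < s →
      |greenEntry (confinedGraph D.carrier D'.carrier δ) (meshDomainFinset D.carrier δ) u v -
        c * Real.log (‖ψ.symm zs - (starRingEnd ℂ) (ψ.symm ys)‖ / ‖ψ.symm zs - ψ.symm ys‖)| ≤ η

/-- **S3b-CW33 · KilledGreenKernelConvergence** (lead c2 reshape of GC; = a PRINTED theorem, Literature debt). The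
tree's named fact `Literature.Probability.LatticeModels.killedGreen_tendsto_of_kernelConvergence` — Chelkak–Wan 2021
Cor. 3.3 (pointwise part) = Chelkak–Smirnov 2011 Thm. 3.9 + Thm. 2.5 on `ℤ²`: the Green's function of simple random
walk killed at its first vertex outside a hole-free induced lattice domain converges, under Carathéodory kernel
convergence of the polygonal domains, to `(2/π) G_Ω`. GC follows from it by the lead's lattice sandwich
(`Anchor.stub_greenConvergence_of_killedGreen_tendsto`). Closing this stub = discharging the Literature fact
(`theorem killedGreen_tendsto_of_kernelConvergence_holds`). [cite: ChelkakWan2021, Corollary 3.3 (§3.1)] -/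
def KilledGreenKernelConvergence : Prop :=
  killedGreen_tendsto_of_kernelConvergence

/-- **SymplecticAnchor** — the `n = -2` end of the flow in loop-model language (PROVED below from
`Determinantal` + `ExcursionRatio`, `symplecticAnchor_of`): along every hull datum the route's ratio
at `(n, t, x) = (-2, -1, 1/4)` tends to `d = d^{b(-2)}`. It is the hypothesis of the window stub. -/
def SymplecticAnchor : Prop :=
  ∀ (D D' : DobrushinDomain) (a b : ℝ → Site 2), SAW.IsEndpointApprox D a b →
    D'.carrier ⊆ D.carrier → D'.pt 0 = D.pt 0 → D'.pt 1 = D.pt 1 →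
    (∃ ε : ℝ, 0 < ε ∧ D'.carrier ∩ Metric.ball (D.pt 0) ε = D.carrier ∩ Metric.ball (D.pt 0) ε ∧
      D'.carrier ∩ Metric.ball (D.pt 1) ε = D.carrier ∩ Metric.ball (D.pt 1) ε) →
    ∀ (φ : ConformalEquiv UpperHalfPlane.upperHalfPlaneSet D.carrier), D.IsChordalUniformizing φ →
    ∀ (A : Set ℂ), A = closure (UpperHalfPlane.upperHalfPlaneSet \
      {z | z ∈ UpperHalfPlane.upperHalfPlaneSet ∧ φ z ∈ D'.carrier}) →
    ∀ (Φ : ConformalEquiv (UpperHalfPlane.upperHalfPlaneSet \ A) UpperHalfPlane.upperHalfPlaneSet)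
      (d : ℝ), IsRestrictionMap A Φ → HasRestrictionDeriv A Φ d →
    Tendsto (fun δ => Rδ (-2 : ℝ) (-1) 4⁻¹ D.carrier D'.carrier δ (a δ) (b δ)) (𝓝[>] 0) (𝓝 d)

/-- **S4 · SymplecticWindow** (conclusion; the stub is `SymplecticAnchor → SymplecticWindow`, XL, the
HARDEST: marginal constructive fermionic RG at the free symplectic fermion). There is `ε₀ ∈ (0, 1]`
such that for every `n ∈ (-2, -2+ε₀]`, along the path `(n, n/2, x_c(n, n/2))` and for every hull
datum, `lim_δ R_δ(n) = d^{b(n)}` with the Coulomb-gas exponent `bExp`. In Grassmann form the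
family is ONE Gaussian `(ψ̄, (1 - xA)ψ)` perturbed by
`(n+2)·[Σ_P x^{|P|} τ^P + (x²/2) Σ_E τ_u τ_v]`, `τ_v = ψ̄_v ψ_v` (coupling `n + 2 → 0`); the
fixed point reached by tuning `x` sits at distance `≍ √(n+2)` (saddle-node in `g = 4/κ`: `n(g)` is
even about `g = 2`), so the expansion parameter is `s = √(n+2)`, not `n + 2`. -/
def SymplecticWindow : Prop :=
  ∃ ε₀ : ℝ, 0 < ε₀ ∧ ε₀ ≤ 1 ∧ ∀ s ∈ Set.Ioc (-2 : ℝ) (-2 + ε₀),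
    ∀ (D D' : DobrushinDomain) (a b : ℝ → Site 2), SAW.IsEndpointApprox D a b →
    D'.carrier ⊆ D.carrier → D'.pt 0 = D.pt 0 → D'.pt 1 = D.pt 1 →
    (∃ ε : ℝ, 0 < ε ∧ D'.carrier ∩ Metric.ball (D.pt 0) ε = D.carrier ∩ Metric.ball (D.pt 0) ε ∧
      D'.carrier ∩ Metric.ball (D.pt 1) ε = D.carrier ∩ Metric.ball (D.pt 1) ε) →
    ∀ (φ : ConformalEquiv UpperHalfPlane.upperHalfPlaneSet D.carrier), D.IsChordalUniformizing φ →
    ∀ (A : Set ℂ), A = closure (UpperHalfPlane.upperHalfPlaneSet \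
      {z | z ∈ UpperHalfPlane.upperHalfPlaneSet ∧ φ z ∈ D'.carrier}) →
    ∀ (Φ : ConformalEquiv (UpperHalfPlane.upperHalfPlaneSet \ A) UpperHalfPlane.upperHalfPlaneSet)
      (d : ℝ), IsRestrictionMap A Φ → HasRestrictionDeriv A Φ d →
    Tendsto (fun δ => Rδ s (s / 2) (xcDim s (s / 2)) D.carrier D'.carrier δ (a δ) (b δ))
      (𝓝[>] 0) (𝓝 (d ^ bExp s))

/-- **S5 · FugacityContinuation** (`δ`-uniform analyticity in the loop fugacity AWAY from the anchor;
L–XL, Lee–Yang type). For every `η ∈ (0, 2)`: the intrinsic critical curve continues analytically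
(`Xc`) to a connected complex neighbourhood `U` of `[-2+η, 0]` inside the strip `-2 < Re z < 2`,
agreeing with `x_c(s, s/2)` at the real points `s ≤ 0` of `U`, and along it the complex ratio
`z ↦ R_δ(z, z/2, Xc z)` is, for every hull geometry, analytic on `U` and bounded there UNIFORMLY in
`δ ∈ (0, δ₀)` (zero-freeness of `Z(Ω_δ; ∅)`, `Z(Ω_δ; a, b)`, `Z^{conf}(∅)` on `U` — including the
real segment, where the weights are signed (triage r1-2) — plus local bounds). NOT claimed on any
neighbourhood of `-2` (√ branch point: `R_δ` is even in `√(n+2)`, triage r1-1/r1-3). -/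
def FugacityContinuation : Prop :=
  ∀ η : ℝ, 0 < η → η < 2 → ∃ (U : Set ℂ) (Xc : ℂ → ℂ),
    IsOpen U ∧ IsPreconnected U ∧ U ⊆ {z : ℂ | -2 < z.re ∧ z.re < 2} ∧
    (∀ s : ℝ, s ∈ Set.Icc (-2 + η) 0 → (s : ℂ) ∈ U) ∧ DifferentiableOn ℂ Xc U ∧
    (∀ s : ℝ, (s : ℂ) ∈ U → s ≤ 0 → Xc s = (xcDim s (s / 2) : ℂ)) ∧
    ∀ (D D' : DobrushinDomain) (a b : ℝ → Site 2), SAW.IsEndpointApprox D a b →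
      D'.carrier ⊆ D.carrier → D'.pt 0 = D.pt 0 → D'.pt 1 = D.pt 1 →
      (∃ ε : ℝ, 0 < ε ∧ D'.carrier ∩ Metric.ball (D.pt 0) ε = D.carrier ∩ Metric.ball (D.pt 0) ε ∧
        D'.carrier ∩ Metric.ball (D.pt 1) ε = D.carrier ∩ Metric.ball (D.pt 1) ε) →
      ∃ δ₀ : ℝ, 0 < δ₀ ∧ ∃ M : ℝ, ∀ δ ∈ Set.Ioo (0 : ℝ) δ₀,
        DifferentiableOn ℂ (fun z : ℂ => Rδ z (z / 2) (Xc z) D.carrier D'.carrier δ (a δ) (b δ)) U ∧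
        ∀ z ∈ U, ‖Rδ z (z / 2) (Xc z) D.carrier D'.carrier δ (a δ) (b δ)‖ ≤ M

/-- **S6 · VitaliTransport** (pure complex analysis, provable now, M). A family `f_δ` of holomorphic
functions on a connected open `U ⊆ {-2 < Re z < 2}` containing `[-2+η, 0]`, bounded by `M` uniformly
in `δ ∈ (0, δ₀)`, converging pointwise on a real sub-interval `(s₁, s₂) ⊆ [-2+η, 0]` to `d^{bExp s}`
(`d > 0`), converges at `0` to `d^{5/8}`: Vitali–Porter (Montel + identity theorem for subsequential
limits along any `δ_k → 0+`), the explicit continuation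
`h(z) = exp(log d · (1 - (3/2π)·Complex.arctan(((2+z)/(2-z))^{1/2})))`, holomorphic on the strip
(`(2+z)/(2-z) ∉ (-∞, 0]` there, its principal square root has positive real part, and
`Complex.arctan w = -(I/2) log((1+wI)/(1-wI))` is holomorphic off `±i[1, ∞)`; `Complex.ofReal_arctan`),
equal to `d^{bExp s}` at real `s ∈ (-2, 2)`, and `bExp 0 = 5/8`. -/
def VitaliTransport : Prop :=
  ∀ η : ℝ, 0 < η → η < 2 → ∀ (U : Set ℂ), IsOpen U → IsPreconnected U →
    U ⊆ {z : ℂ | -2 < z.re ∧ z.re < 2} → (∀ s : ℝ, s ∈ Set.Icc (-2 + η) 0 → (s : ℂ) ∈ U) →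
    ∀ (f : ℝ → ℂ → ℂ) (M δ₀ : ℝ), 0 < δ₀ →
    (∀ δ ∈ Set.Ioo (0 : ℝ) δ₀, DifferentiableOn ℂ (f δ) U ∧ ∀ z ∈ U, ‖f δ z‖ ≤ M) →
    ∀ d : ℝ, 0 < d → ∀ s₁ s₂ : ℝ, -2 + η ≤ s₁ → s₁ < s₂ → s₂ ≤ 0 →
    (∀ s ∈ Set.Ioo s₁ s₂, Tendsto (fun δ => f δ s) (𝓝[>] 0) (𝓝 ((d ^ bExp s : ℝ) : ℂ))) →
    Tendsto (fun δ => f δ 0) (𝓝[>] 0) (𝓝 ((d ^ ((5 : ℝ) / 8) : ℝ) : ℂ))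

/-- **S7 · SAWCriticalPoint** (known, provable now from the tree's Hammersley–Welsh bounds, M): the
intrinsic critical curve passes through the SAW point, `x_c(0, 0) = 1/μ(ℤ²)`. At `(0, 0, x)` the
susceptibility of the box `Λ_k` is the polynomial `Σ x^{|γ|}` over self-avoiding walks from `0` inside
`[-k, k] × [0, k]` (incl. the trivial walk), so `chiCoeff 0 0 k = h⁺_k`, the number of `k`-step SAWs from
`0` in the closed upper half-plane, and `b_k ≤ h⁺_k ≤ c_k` (vertical bridges are such walks); with
`c_k ≤ μ^k e^{κ√k}` (`BDGS2012_HammersleyWelsh_holds`) and `e^{-c√k} μ^k ≤ b_k`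
(`Zd.exp_mul_pow_le_bridgeCount` / `DKY2014_eq21_holds`) the sequence `h⁺_k r^k` is bounded for
`r < 1/μ` and unbounded for `r > 1/μ`, so the `sSup` over `[0, 1]` is `1/μ = SAW.criticalFugacity`
whatever happens AT `1/μ`. -/
def SAWCriticalPoint : Prop :=
  xcDim 0 0 = SAW.criticalFugacity

/-! ## 5. Registered stubs -/

/-! The `stub_*` theorems are the registered obligations (sorried); `Registered.stub_*` are the
name-keyed `abbrev` aliases of their statements taken as the hypotheses of `AvoidanceLimit_of` (the
skeleton audit admits a hypothesis whose head's last name component is a declared stub — device of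
`Summits/FinalStateConjecture/…/Cruxes/TameCensorship/Lines/necks-are-one-way-valves.lean`). -/
namespace Registered

abbrev stub_sawEndpoint : Prop := SAWEndpointIdentity
abbrev stub_determinantal : Prop := Determinantal
abbrev stub_greenRatioDecomposition : Prop := GreenRatioDecomposition
abbrev stub_sphereRatioLimit : Prop := SphereRatioLimit
abbrev stub_latticeTopology : Prop := LatticeTopology
abbrev stub_ratioOscillation : Prop := RatioOscillation
abbrev stub_interiorRatioLimit : Prop := InteriorRatioLimit
abbrev stub_uniformBHP : Prop := UniformBHP
abbrev stub_latticeLocalConnectivity : Prop := LatticeLocalConnectivity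
abbrev stub_germCrossRatio : Prop := GermCrossRatio
abbrev stub_germTwoSided : Prop := GermTwoSided
abbrev stub_germUpper : Prop := GermUpper
abbrev stub_greenConvergence : Prop := GreenConvergence
abbrev stub_killedGreenKernelConvergence : Prop := KilledGreenKernelConvergence
abbrev stub_symplecticWindow : Prop := SymplecticAnchor → SymplecticWindow
abbrev stub_fugacityContinuation : Prop := FugacityContinuation
abbrev stub_vitaliTransport : Prop := VitaliTransport
abbrev stub_sawCriticalPoint : Prop := SAWCriticalPoint

end Registered

/-- STUB S1 — CLOSED (landed `Anchor.stub_sawEndpoint`, p90984): the `n = 0` end of the ratio IS the crux's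
avoidance probability (`SAWEndpointIdentity`, unfolded so that the registered signature is the literal statement). -/
theorem stub_sawEndpoint :
    ∀ (Ω S : Set ℂ) (δ : ℝ) (a b : Site 2), Bornology.IsBounded Ω → 0 < δ → a ≠ b →
      ((SAW.law Ω δ a b).map (fun γ => γ.curve)) (CurveClass.rangeSubset (closure S)) =
        ENNReal.ofReal (Rδ (0 : ℝ) 0 SAW.criticalFugacity Ω S δ a b) :=
  Theorems.AvoidanceLimit.Anchor.stub_sawEndpoint

/-- STUB S2 — CLOSED (landed `Anchor.stub_determinantal`, p93840 + helper files p91155, p91341, p83569,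
p92568, p93781): adjugate path expansion / `det = loops(-2) + dimers(-1)` (`Determinantal`, unfolded). -/
theorem stub_determinantal :
    ∀ (H : SimpleGraph (Site 2)) [H.LocallyFinite], H ≤ zdGraph 2 →
      ∀ (Λ : Finset (Site 2)) (x : ℝ) (a b : Site 2) (ha : a ∈ Λ) (hb : b ∈ Λ), a ≠ b →
        dimerPF (-2 : ℝ) (-1) x H Λ ({a} ∆ {b}) =
            ((1 : Matrix Λ Λ ℝ) - x • adjMat H Λ).adjugate ⟨a, ha⟩ ⟨b, hb⟩ ∧
          dimerPF (-2 : ℝ) (-1) x H Λ ∅ = ((1 : Matrix Λ Λ ℝ) - x • adjMat H Λ).det :=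
  fun H _ hH Λ x a b ha hb hab => Theorems.AvoidanceLimit.Anchor.stub_determinantal H hH Λ x a b ha hb hab

/-- STUB S3a — CLOSED (landed `Anchor.stub_greenRatioDecomposition`, p98089, lead c1 wave 1): the two-sided
first-exit / last-entrance decomposition (`GreenRatioDecomposition`, unfolded). -/
theorem stub_greenRatioDecomposition :
    ∀ (Ω S : Set ℂ) (pa pb : ℂ) (ε r δ : ℝ) (a b : Site 2) (m M : ℝ),
      Bornology.IsBounded Ω → 0 < δ → 0 < r → r + 2 * δ ≤ ε →
      S ∩ Metric.ball pa ε = Ω ∩ Metric.ball pa ε → S ∩ Metric.ball pb ε = Ω ∩ Metric.ball pb ε →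
      2 * r + 2 * δ ≤ dist pa pb →
      dist (meshPoint δ a) pa < r → dist (meshPoint δ b) pb < r →
      0 < greenEntry (discreteDomainGraph Ω δ) (meshDomainFinset Ω δ) a b →
      (∀ z y : Site 2, r ≤ dist (meshPoint δ z) pa → dist (meshPoint δ z) pa < r + δ →
        r ≤ dist (meshPoint δ y) pb → dist (meshPoint δ y) pb < r + δ →
        0 < greenEntry (discreteDomainGraph Ω δ) (meshDomainFinset Ω δ) z y →
        m ≤ greenEntry (confinedGraph Ω S δ) (meshDomainFinset Ω δ) z y /
            greenEntry (discreteDomainGraph Ω δ) (meshDomainFinset Ω δ) z y ∧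
          greenEntry (confinedGraph Ω S δ) (meshDomainFinset Ω δ) z y /
            greenEntry (discreteDomainGraph Ω δ) (meshDomainFinset Ω δ) z y ≤ M) →
      m ≤ greenRatio Ω S δ a b ∧ greenRatio Ω S δ a b ≤ M :=
  Theorems.AvoidanceLimit.Anchor.stub_greenRatioDecomposition

/-- STUB S3b-TOP — CLOSED (landed `Anchor.stub_latticeTopology`, p104172, lead c1): lattice topology of Jordan
domains (`LatticeTopology`, unfolded). -/
theorem stub_latticeTopology :
    ∀ (D : DobrushinDomain) (zs ys : ℂ), zs ∈ D.carrier → ys ∈ D.carrier → ∀ s : ℝ, 0 < s →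
      ∀ᶠ δ in 𝓝[>] (0 : ℝ), ∃ u v : Site 2, dist (meshPoint δ u) zs < s ∧ dist (meshPoint δ v) ys < s ∧
      0 < greenEntry (discreteDomainGraph D.carrier δ) (meshDomainFinset D.carrier δ) u v :=
  Theorems.AvoidanceLimit.Anchor.stub_latticeTopology

/-- STUB S3b-UBHP-T — CLOSED (v11, lead c4: `latticeLocalConnectivity` p122661 = `latticeLocalConnectivity_of` p122370 fed by
`exists_localJordanNbhd` p122428 and `exists_discreteDomainGraph_walk_of_reachable` p122301): lattice uniform local connectivity of a Jordan domain at a boundary point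
(`LatticeLocalConnectivity`, unfolded). -/
theorem stub_latticeLocalConnectivity :
    ∀ (D : JordanDomain) (p : ℂ), p ∈ frontier D.carrier → ∀ ρ : ℝ, 0 < ρ → ∃ r : ℝ, 0 < r ∧
      ∀ᶠ δ in 𝓝[>] (0 : ℝ), ∀ u v : Site 2, u ∈ meshDomain D.carrier δ → v ∈ meshDomain D.carrier δ →
        dist (meshPoint δ u) p < r → dist (meshPoint δ v) p < r →
        ∃ w : (discreteDomainGraph D.carrier δ).Walk u v,
          ∀ z ∈ w.support, z ∈ meshDomain D.carrier δ ∧ dist (meshPoint δ z) p < ρ :=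
  Theorems.AvoidanceLimit.Anchor.latticeLocalConnectivity

/-- STUB S3b-UBHP-UP (XL; lead c7 v14 reshape — the factorisation UPPER BOUND at an admissible hub, Chelkak 2016 Prop. 3.3 for
the edge-killed walk in the lattice germ regions; `GermUpper`, unfolded). THE open analytic obligation of the anchor. -/
theorem stub_germUpper : GermUpper := by
  sorry

/-- S3b-UBHP-TS — DERIVED (v14, lead c7: `germTwoSided_of_upper stub_germUpper`; hub = `germHub_ge` + `exists_clean_hubBox`,
lower bound = `hub_twoSided`): the hub factorisation of the exit kernel (`GermTwoSided`, unfolded). -/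
theorem stub_germTwoSided :
    ∀ (D : JordanDomain), ∀ b ∈ frontier D.carrier, ∃ K c₀ C₀ s₀ : ℝ, 1 < K ∧ 0 < c₀ ∧ c₀ ≤ C₀ ∧ 0 < s₀ ∧
      ∀ (s s' : ℝ) (hs : 0 < s) (hs' : 0 < s'), s' = K * s → s' < s₀ →
      ∀ (g o : ℂ), g ∈ D.carrier ∩ Literature.Topology.PlaneTopology.box b s → o ∈ D.carrier →
      o ∉ closedBox b s' → TwoOff D (boxJD b hs) → TwoOff D (boxJD b hs') →
      ∀ᶠ δ in 𝓝[>] (0 : ℝ), ∃ f gx : Site 2 → ℝ, (∀ u, 0 ≤ f u) ∧ (∀ x, 0 ≤ gx x) ∧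
        ∀ u ∈ germExits D b hs g o δ, ∀ x ∈ germExits D b hs' g o δ,
          c₀ * (f u * gx x) ≤ killedPoisson (discreteDomainGraph D.carrier δ) (germSites D b hs' g o δ) u x ∧
            killedPoisson (discreteDomainGraph D.carrier δ) (germSites D b hs' g o δ) u x ≤ C₀ * (f u * gx x) :=
  germTwoSided_of_upper stub_germUpper

/-- S3b-UBHP-CR — DERIVED (v13, lead c6: `germCrossRatio_of_twoSided stub_germTwoSided`; the c5 statement, shared verbatim with
`Literature…uniformBHP_of_crossRatio` / `KozdronLawler2005_martinRatioBoundaryLimit_of_crossRatio`): the one-annulus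
cross-ratio bound for the exit kernels of the lattice germ regions of the edge-killed walk (`GermCrossRatio`, unfolded). -/
theorem stub_germCrossRatio :
    ∀ (D : JordanDomain), ∀ b ∈ frontier D.carrier, ∃ K C s₀ : ℝ, 1 < K ∧ 1 ≤ C ∧ 0 < s₀ ∧
      ∀ (s s' : ℝ) (hs : 0 < s) (hs' : 0 < s'), s' = K * s → s' < s₀ →
      ∀ (g o : ℂ), g ∈ D.carrier ∩ Literature.Topology.PlaneTopology.box b s → o ∈ D.carrier →
      o ∉ closedBox b s' → TwoOff D (boxJD b hs) → TwoOff D (boxJD b hs') →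
      ∀ᶠ δ in 𝓝[>] (0 : ℝ),
        ∀ u ∈ germExits D b hs g o δ, ∀ v ∈ germExits D b hs g o δ,
        ∀ x ∈ germExits D b hs' g o δ, ∀ y ∈ germExits D b hs' g o δ,
          killedPoisson (discreteDomainGraph D.carrier δ) (germSites D b hs' g o δ) u x *
              killedPoisson (discreteDomainGraph D.carrier δ) (germSites D b hs' g o δ) v y ≤
            C * (killedPoisson (discreteDomainGraph D.carrier δ) (germSites D b hs' g o δ) v x *
              killedPoisson (discreteDomainGraph D.carrier δ) (germSites D b hs' g o δ) u y) :=
  germCrossRatio_of_twoSided stub_germTwoSided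

/-- S3b-UBHP — DERIVED (v12, lead c5: `uniformBHP_of_germCrossRatio` = the tree's `uniformBHP_of_crossRatio`, Chelkak–Wan's
iteration along the germ-region chain, through the landed `adjMat`/`killedAvg` dictionary, fed by the stub `stub_germCrossRatio`;
v11's route `uniformBHP_of_localConnectivity_of_crossRatio` via the CLOSED (T) and the retired Euclidean stub stays in the tree):
the uniform discrete boundary Harnack principle for the edge-killed `Ω_δ`-walk at a marked prime end (`UniformBHP`, unfolded). -/
theorem stub_uniformBHP :
    ∀ (D : DobrushinDomain) (i : Fin 2) (R : ℝ), 0 < R → ∀ η : ℝ, 0 < η → ∃ r : ℝ, 0 < r ∧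
      ∀ᶠ δ in 𝓝[>] (0 : ℝ), ∀ h₁ h₂ : ↥(meshDomainFinset D.carrier δ) → ℝ,
        (∀ x, 0 ≤ h₁ x) → (∀ x, 0 ≤ h₂ x) →
        (∀ x : ↥(meshDomainFinset D.carrier δ), dist (meshPoint δ x) (D.pt i) < R →
          Matrix.mulVec ((4 : ℝ)⁻¹ • adjMat (discreteDomainGraph D.carrier δ)
            (meshDomainFinset D.carrier δ)) h₁ x = h₁ x) →
        (∀ x : ↥(meshDomainFinset D.carrier δ), dist (meshPoint δ x) (D.pt i) < R →
          Matrix.mulVec ((4 : ℝ)⁻¹ • adjMat (discreteDomainGraph D.carrier δ)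
            (meshDomainFinset D.carrier δ)) h₂ x = h₂ x) →
        ∀ z z' : ↥(meshDomainFinset D.carrier δ), dist (meshPoint δ z) (D.pt i) < r →
          dist (meshPoint δ z') (D.pt i) < r → h₁ z * h₂ z' ≤ (1 + η) * (h₁ z' * h₂ z) :=
  Theorems.AvoidanceLimit.Anchor.uniformBHP_of_germCrossRatio stub_germCrossRatio

/-- STUB S3b-CW33 — CLOSED (v10, lead c3): the printed Chelkak–Wan Cor. 3.3, verbatim the tree's named fact
`killedGreen_tendsto_of_kernelConvergence` (`KilledGreenKernelConvergence`, unfolded), DISCHARGED in the tree by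
`killedGreen_tendsto_of_kernelConvergence_holds` (`Literature/Probability/LatticeModels/DiscreteGreenKernelConvergenceProofs.lean`). -/
theorem stub_killedGreenKernelConvergence : killedGreen_tendsto_of_kernelConvergence :=
  killedGreen_tendsto_of_kernelConvergence_holds

/-- S3b-GC — CLOSED (landed `Anchor.stub_greenConvergence`, p118884, lead c3: lead c2's inner/outer hole-free lattice
sandwich `Anchor.stub_greenConvergence_of_killedGreen_tendsto` fed with the discharged CW33) (`GreenConvergence`, unfolded). -/
theorem stub_greenConvergence :
    ∃ c : ℝ, 0 < c ∧ ∀ (D D' : JordanDomain), D'.carrier ⊆ D.carrier →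
      ∀ (ψ : ConformalEquiv UpperHalfPlane.upperHalfPlaneSet D'.carrier),
      ∀ zs ys : ℂ, zs ∈ D'.carrier → ys ∈ D'.carrier → zs ≠ ys →
      ∀ η : ℝ, 0 < η → ∃ s : ℝ, 0 < s ∧ ∀ᶠ δ in 𝓝[>] (0 : ℝ), ∀ u v : Site 2,
        dist (meshPoint δ u) zs < s → dist (meshPoint δ v) ys < s →
        |greenEntry (confinedGraph D.carrier D'.carrier δ) (meshDomainFinset D.carrier δ) u v -
          c * Real.log (‖ψ.symm zs - (starRingEnd ℂ) (ψ.symm ys)‖ / ‖ψ.symm zs - ψ.symm ys‖)| ≤ η :=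
  Theorems.AvoidanceLimit.Anchor.stub_greenConvergence_of_killedGreen_tendsto stub_killedGreenKernelConvergence

/-- S3b-BHP — DERIVED (landed reduction `Anchor.stub_ratioOscillation_of_uniformBHP`, p106247, lead c1 wave 2)
from UBHP (`RatioOscillation`, unfolded). -/
theorem stub_ratioOscillation :
    ∀ (D D' : DobrushinDomain), D'.carrier ⊆ D.carrier → D'.pt 0 = D.pt 0 → D'.pt 1 = D.pt 1 →
      (∃ ε : ℝ, 0 < ε ∧ D'.carrier ∩ Metric.ball (D.pt 0) ε = D.carrier ∩ Metric.ball (D.pt 0) ε ∧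
      D'.carrier ∩ Metric.ball (D.pt 1) ε = D.carrier ∩ Metric.ball (D.pt 1) ε) →
      ∀ η : ℝ, 0 < η → ∃ r : ℝ, 0 < r ∧ ∀ᶠ δ in 𝓝[>] (0 : ℝ), ∀ z z' y y' : Site 2,
      dist (meshPoint δ z) (D.pt 0) < r → dist (meshPoint δ z') (D.pt 0) < r →
      dist (meshPoint δ y) (D.pt 1) < r → dist (meshPoint δ y') (D.pt 1) < r →
      0 < greenEntry (discreteDomainGraph D.carrier δ) (meshDomainFinset D.carrier δ) z y →
      0 < greenEntry (discreteDomainGraph D.carrier δ) (meshDomainFinset D.carrier δ) z' y' →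
      |greenEntry (confinedGraph D.carrier D'.carrier δ) (meshDomainFinset D.carrier δ) z y /
      greenEntry (discreteDomainGraph D.carrier δ) (meshDomainFinset D.carrier δ) z y -
      greenEntry (confinedGraph D.carrier D'.carrier δ) (meshDomainFinset D.carrier δ) z' y' /
      greenEntry (discreteDomainGraph D.carrier δ) (meshDomainFinset D.carrier δ) z' y'| ≤ η :=
  Theorems.AvoidanceLimit.Anchor.stub_ratioOscillation_of_uniformBHP stub_uniformBHP

/-- S3b-INT — DERIVED (landed reduction `Anchor.stub_interiorRatioLimit_of_greenConvergence`, p105941, lead c1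
wave 2) from GC (`InteriorRatioLimit`, unfolded). -/
theorem stub_interiorRatioLimit :
    ∀ (D D' : DobrushinDomain), D'.carrier ⊆ D.carrier → D'.pt 0 = D.pt 0 → D'.pt 1 = D.pt 1 →
      (∃ ε : ℝ, 0 < ε ∧ D'.carrier ∩ Metric.ball (D.pt 0) ε = D.carrier ∩ Metric.ball (D.pt 0) ε ∧
      D'.carrier ∩ Metric.ball (D.pt 1) ε = D.carrier ∩ Metric.ball (D.pt 1) ε) →
      ∀ (φ : ConformalEquiv UpperHalfPlane.upperHalfPlaneSet D.carrier), D.IsChordalUniformizing φ →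
      ∀ (A : Set ℂ), A = closure (UpperHalfPlane.upperHalfPlaneSet \
      {z | z ∈ UpperHalfPlane.upperHalfPlaneSet ∧ φ z ∈ D'.carrier}) →
      ∀ (Φ : ConformalEquiv (UpperHalfPlane.upperHalfPlaneSet \ A) UpperHalfPlane.upperHalfPlaneSet),
      IsRestrictionMap A Φ →
      ∀ zs ys : ℂ, zs ∈ D'.carrier → ys ∈ D'.carrier → zs ≠ ys →
      ∀ η : ℝ, 0 < η → ∃ s : ℝ, 0 < s ∧ ∀ᶠ δ in 𝓝[>] (0 : ℝ), ∀ u v : Site 2,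
      dist (meshPoint δ u) zs < s → dist (meshPoint δ v) ys < s →
      0 < greenEntry (discreteDomainGraph D.carrier δ) (meshDomainFinset D.carrier δ) u v →
      |greenEntry (confinedGraph D.carrier D'.carrier δ) (meshDomainFinset D.carrier δ) u v /
      greenEntry (discreteDomainGraph D.carrier δ) (meshDomainFinset D.carrier δ) u v -
      Real.log (‖Φ (φ.symm zs) - (starRingEnd ℂ) (Φ (φ.symm ys))‖ / ‖Φ (φ.symm zs) - Φ (φ.symm ys)‖) /
      Real.log (‖φ.symm zs - (starRingEnd ℂ) (φ.symm ys)‖ / ‖φ.symm zs - φ.symm ys‖)| ≤ η :=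
  Theorems.AvoidanceLimit.Anchor.stub_interiorRatioLimit_of_greenConvergence stub_greenConvergence

/-- S3b — DERIVED (landed assembly `Anchor.stub_sphereRatioLimit_of_oscillation_of_interiorLimit`, p101564,
lead c1 wave 1): TOP + BHP + INT ⇒ uniform sphere-ratio convergence (`SphereRatioLimit`, unfolded). -/
theorem stub_sphereRatioLimit :
    ∀ (D D' : DobrushinDomain), D'.carrier ⊆ D.carrier → D'.pt 0 = D.pt 0 → D'.pt 1 = D.pt 1 →
      (∃ ε : ℝ, 0 < ε ∧ D'.carrier ∩ Metric.ball (D.pt 0) ε = D.carrier ∩ Metric.ball (D.pt 0) ε ∧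
        D'.carrier ∩ Metric.ball (D.pt 1) ε = D.carrier ∩ Metric.ball (D.pt 1) ε) →
      ∀ (φ : ConformalEquiv UpperHalfPlane.upperHalfPlaneSet D.carrier), D.IsChordalUniformizing φ →
      ∀ (A : Set ℂ), A = closure (UpperHalfPlane.upperHalfPlaneSet \
        {z | z ∈ UpperHalfPlane.upperHalfPlaneSet ∧ φ z ∈ D'.carrier}) →
      ∀ (Φ : ConformalEquiv (UpperHalfPlane.upperHalfPlaneSet \ A) UpperHalfPlane.upperHalfPlaneSet)
        (d : ℝ), IsRestrictionMap A Φ → HasRestrictionDeriv A Φ d →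
      ∀ η : ℝ, 0 < η → ∃ r₀ : ℝ, 0 < r₀ ∧ ∀ r ∈ Set.Ioo (0 : ℝ) r₀, ∀ᶠ δ in 𝓝[>] (0 : ℝ),
        ∀ z y : Site 2, r ≤ dist (meshPoint δ z) (D.pt 0) → dist (meshPoint δ z) (D.pt 0) < r + δ →
          r ≤ dist (meshPoint δ y) (D.pt 1) → dist (meshPoint δ y) (D.pt 1) < r + δ →
          0 < greenEntry (discreteDomainGraph D.carrier δ) (meshDomainFinset D.carrier δ) z y →
          |greenEntry (confinedGraph D.carrier D'.carrier δ) (meshDomainFinset D.carrier δ) z y /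
              greenEntry (discreteDomainGraph D.carrier δ) (meshDomainFinset D.carrier δ) z y - d| ≤ η :=
  Theorems.AvoidanceLimit.Anchor.stub_sphereRatioLimit_of_oscillation_of_interiorLimit
    stub_latticeTopology stub_ratioOscillation stub_interiorRatioLimit

/-- STUB S4 (XL, HARDEST — the bet of the line): the window out of the symplectic fermion
(`SymplecticAnchor → SymplecticWindow`, unfolded). -/
theorem stub_symplecticWindow :
    (∀ (D D' : DobrushinDomain) (a b : ℝ → Site 2), SAW.IsEndpointApprox D a b →
      D'.carrier ⊆ D.carrier → D'.pt 0 = D.pt 0 → D'.pt 1 = D.pt 1 →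
      (∃ ε : ℝ, 0 < ε ∧ D'.carrier ∩ Metric.ball (D.pt 0) ε = D.carrier ∩ Metric.ball (D.pt 0) ε ∧
        D'.carrier ∩ Metric.ball (D.pt 1) ε = D.carrier ∩ Metric.ball (D.pt 1) ε) →
      ∀ (φ : ConformalEquiv UpperHalfPlane.upperHalfPlaneSet D.carrier), D.IsChordalUniformizing φ →
      ∀ (A : Set ℂ), A = closure (UpperHalfPlane.upperHalfPlaneSet \
        {z | z ∈ UpperHalfPlane.upperHalfPlaneSet ∧ φ z ∈ D'.carrier}) →
      ∀ (Φ : ConformalEquiv (UpperHalfPlane.upperHalfPlaneSet \ A) UpperHalfPlane.upperHalfPlaneSet)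
        (d : ℝ), IsRestrictionMap A Φ → HasRestrictionDeriv A Φ d →
      Tendsto (fun δ => Rδ (-2 : ℝ) (-1) 4⁻¹ D.carrier D'.carrier δ (a δ) (b δ)) (𝓝[>] 0) (𝓝 d)) →
    ∃ ε₀ : ℝ, 0 < ε₀ ∧ ε₀ ≤ 1 ∧ ∀ s ∈ Set.Ioc (-2 : ℝ) (-2 + ε₀),
      ∀ (D D' : DobrushinDomain) (a b : ℝ → Site 2), SAW.IsEndpointApprox D a b →
      D'.carrier ⊆ D.carrier → D'.pt 0 = D.pt 0 → D'.pt 1 = D.pt 1 →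
      (∃ ε : ℝ, 0 < ε ∧ D'.carrier ∩ Metric.ball (D.pt 0) ε = D.carrier ∩ Metric.ball (D.pt 0) ε ∧
        D'.carrier ∩ Metric.ball (D.pt 1) ε = D.carrier ∩ Metric.ball (D.pt 1) ε) →
      ∀ (φ : ConformalEquiv UpperHalfPlane.upperHalfPlaneSet D.carrier), D.IsChordalUniformizing φ →
      ∀ (A : Set ℂ), A = closure (UpperHalfPlane.upperHalfPlaneSet \
        {z | z ∈ UpperHalfPlane.upperHalfPlaneSet ∧ φ z ∈ D'.carrier}) →
      ∀ (Φ : ConformalEquiv (UpperHalfPlane.upperHalfPlaneSet \ A) UpperHalfPlane.upperHalfPlaneSet)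
        (d : ℝ), IsRestrictionMap A Φ → HasRestrictionDeriv A Φ d →
      Tendsto (fun δ => Rδ s (s / 2) (xcDim s (s / 2)) D.carrier D'.carrier δ (a δ) (b δ))
        (𝓝[>] 0) (𝓝 (d ^ bExp s)) := by
  sorry

/-- STUB S5 (L–XL): `δ`-uniform analytic continuation in the loop fugacity on `[-2+η, 0]`, every `η > 0`
(`FugacityContinuation`, unfolded). -/
theorem stub_fugacityContinuation :
    ∀ η : ℝ, 0 < η → η < 2 → ∃ (U : Set ℂ) (Xc : ℂ → ℂ),
      IsOpen U ∧ IsPreconnected U ∧ U ⊆ {z : ℂ | -2 < z.re ∧ z.re < 2} ∧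
      (∀ s : ℝ, s ∈ Set.Icc (-2 + η) 0 → (s : ℂ) ∈ U) ∧ DifferentiableOn ℂ Xc U ∧
      (∀ s : ℝ, (s : ℂ) ∈ U → s ≤ 0 → Xc s = (xcDim s (s / 2) : ℂ)) ∧
      ∀ (D D' : DobrushinDomain) (a b : ℝ → Site 2), SAW.IsEndpointApprox D a b →
        D'.carrier ⊆ D.carrier → D'.pt 0 = D.pt 0 → D'.pt 1 = D.pt 1 →
        (∃ ε : ℝ, 0 < ε ∧ D'.carrier ∩ Metric.ball (D.pt 0) ε = D.carrier ∩ Metric.ball (D.pt 0) ε ∧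
          D'.carrier ∩ Metric.ball (D.pt 1) ε = D.carrier ∩ Metric.ball (D.pt 1) ε) →
        ∃ δ₀ : ℝ, 0 < δ₀ ∧ ∃ M : ℝ, ∀ δ ∈ Set.Ioo (0 : ℝ) δ₀,
          DifferentiableOn ℂ (fun z : ℂ => Rδ z (z / 2) (Xc z) D.carrier D'.carrier δ (a δ) (b δ)) U ∧
          ∀ z ∈ U, ‖Rδ z (z / 2) (Xc z) D.carrier D'.carrier δ (a δ) (b δ)‖ ≤ M := by
  sorry

/-- STUB S6 — CLOSED (landed `Anchor.stub_vitaliTransport`, p86507): Vitali–Porter transport of the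
Coulomb-gas exponent to `n = 0` (`VitaliTransport`, unfolded). -/
theorem stub_vitaliTransport :
    ∀ η : ℝ, 0 < η → η < 2 → ∀ (U : Set ℂ), IsOpen U → IsPreconnected U →
      U ⊆ {z : ℂ | -2 < z.re ∧ z.re < 2} → (∀ s : ℝ, s ∈ Set.Icc (-2 + η) 0 → (s : ℂ) ∈ U) →
      ∀ (f : ℝ → ℂ → ℂ) (M δ₀ : ℝ), 0 < δ₀ →
      (∀ δ ∈ Set.Ioo (0 : ℝ) δ₀, DifferentiableOn ℂ (f δ) U ∧ ∀ z ∈ U, ‖f δ z‖ ≤ M) →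
      ∀ d : ℝ, 0 < d → ∀ s₁ s₂ : ℝ, -2 + η ≤ s₁ → s₁ < s₂ → s₂ ≤ 0 →
      (∀ s ∈ Set.Ioo s₁ s₂, Tendsto (fun δ => f δ s) (𝓝[>] 0) (𝓝 ((d ^ bExp s : ℝ) : ℂ))) →
      Tendsto (fun δ => f δ 0) (𝓝[>] 0) (𝓝 ((d ^ ((5 : ℝ) / 8) : ℝ) : ℂ)) :=
  Theorems.AvoidanceLimit.Anchor.stub_vitaliTransport

/-- STUB S7 — CLOSED (landed `Anchor.stub_sawCriticalPoint`, p88356): `x_c(0,0) = 1/μ` (Hammersley–Welsh)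
(`SAWCriticalPoint`, unfolded). -/
theorem stub_sawCriticalPoint :
    xcDim 0 0 = SAW.criticalFugacity :=
  Theorems.AvoidanceLimit.Anchor.stub_sawCriticalPoint

/-! The unfolded stubs are, by `Iff.rfl`, the named statements of §4. -/
example : SAWEndpointIdentity := stub_sawEndpoint
example : Determinantal := stub_determinantal
example : GreenRatioDecomposition := stub_greenRatioDecomposition
example : SphereRatioLimit := stub_sphereRatioLimit
example : LatticeTopology := stub_latticeTopology
example : RatioOscillation := stub_ratioOscillation
example : InteriorRatioLimit := stub_interiorRatioLimit
example : UniformBHP := stub_uniformBHP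
example : LatticeLocalConnectivity := stub_latticeLocalConnectivity
example : GermCrossRatio := stub_germCrossRatio
example : GermTwoSided := stub_germTwoSided
example : GreenConvergence := stub_greenConvergence
example : KilledGreenKernelConvergence := stub_killedGreenKernelConvergence
example : SymplecticAnchor → SymplecticWindow := stub_symplecticWindow
example : FugacityContinuation := stub_fugacityContinuation
example : VitaliTransport := stub_vitaliTransport
example : SAWCriticalPoint := stub_sawCriticalPoint

/-! ## 6. Glue (sorry-free) -/

/-- Along an endpoint approximation, eventually `δ > 0`, `a_δ ≠ b_δ` and both legs lie in the volume
`meshDomainFinset D δ` (uses `IsEndpointApprox.reachable` — Disproof: reachability is load-bearing). -/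
theorem eventually_good {D : DobrushinDomain} {a b : ℝ → Site 2} (hab : SAW.IsEndpointApprox D a b) :
    ∀ᶠ δ in 𝓝[>] (0 : ℝ), 0 < δ ∧ a δ ≠ b δ ∧
      a δ ∈ meshDomainFinset D.carrier δ ∧ b δ ∈ meshDomainFinset D.carrier δ := by
  have h0 : ∀ᶠ δ in 𝓝[>] (0 : ℝ), 0 < δ := eventually_mem_nhdsWithin
  have hpq : D.pt 0 ≠ D.pt 1 := fun h => absurd (D.pt_injective h) (by decide)
  have hr : 0 < dist (D.pt 0) (D.pt 1) / 2 := by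
    have := dist_pos.2 hpq
    positivity
  have ha := (Metric.tendsto_nhds.1 hab.tendsto_fst) _ hr
  have hb := (Metric.tendsto_nhds.1 hab.tendsto_snd) _ hr
  have hne : ∀ᶠ δ in 𝓝[>] (0 : ℝ), a δ ≠ b δ := by
    filter_upwards [ha, hb] with δ hδa hδb heq
    rw [heq] at hδa
    have h3 := dist_triangle (D.pt 0) (meshPoint δ (b δ)) (D.pt 1)
    rw [dist_comm] at hδa
    linarith
  filter_upwards [h0, hne, hab.reachable] with δ hδ hne hreach
  obtain ⟨p⟩ := hreach
  obtain ⟨w, hadj, -, -⟩ := p.exists_eq_cons_of_ne hne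
  obtain ⟨w', hadj', -, -⟩ := p.reverse.exists_eq_cons_of_ne hne.symm
  have hD : Bornology.IsBounded D.carrier := D.isBounded
  have hmem : ∀ v, v ∈ meshDomain D.carrier δ → v ∈ meshDomainFinset D.carrier δ := fun v hv => by
    rw [← Finset.mem_coe, coe_meshDomainFinset hD hδ]
    exact hv
  exact ⟨hδ, hne, hmem _ (discreteDomainGraph_adj_iff.1 hadj).2.1,
    hmem _ (discreteDomainGraph_adj_iff.1 hadj').2.1⟩

/-- At the anchor parameters the route's ratio IS the Green's-function ratio (by `Determinantal` and
`(1 - xA)⁻¹ = det⁻¹ · adj`). -/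
theorem Rδ_anchor_eq_greenRatio (h2 : Determinantal) {Ω S : Set ℂ} {δ : ℝ} {a b : Site 2}
    (ha : a ∈ meshDomainFinset Ω δ) (hb : b ∈ meshDomainFinset Ω δ) (hne : a ≠ b) :
    Rδ (-2 : ℝ) (-1) 4⁻¹ Ω S δ a b = greenRatio Ω S δ a b := by
  obtain ⟨e1, e1'⟩ := h2 (confinedGraph Ω S δ) (confinedGraph_le_zdGraph Ω S δ)
    (meshDomainFinset Ω δ) 4⁻¹ a b ha hb hne
  obtain ⟨e2, e2'⟩ := h2 (discreteDomainGraph Ω δ)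
    ((discreteDomainGraph_le_meshGraph Ω δ).trans (meshGraph_le_zdGraph Ω δ))
    (meshDomainFinset Ω δ) 4⁻¹ a b ha hb hne
  simp only [Rδ, ratioDim, twoLegDim, greenRatio, greenEntry, dif_pos (And.intro ha hb)]
  rw [e1, e1', e2, e2', Matrix.inv_def, Matrix.inv_def, Matrix.smul_apply, Matrix.smul_apply,
    smul_eq_mul, smul_eq_mul, Ring.inverse_eq_inv, Ring.inverse_eq_inv]
  ring

/-- **S3 from its reshape (lead c1): `GreenRatioDecomposition ∧ SphereRatioLimit ⇒ ExcursionRatio`.**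
Given `η > 0`, `S3b` supplies `r₀`; take `r = min (r₀/2) (min (ε/4) (|a − b|/8))`; for small `δ` the legs
satisfy `δa_δ ∈ B(a, r)`, `δb_δ ∈ B(b, r)` (endpoint approximation), the denominator is positive
(`eventually_greenEntry_pos`) and the sphere bound of `S3b` holds with `[d − η/2, d + η/2]`, which `S3a`
transfers to `greenRatio`. -/
theorem excursionRatio_of (h3a : GreenRatioDecomposition) (h3b : SphereRatioLimit) : ExcursionRatio := by
  intro D D' a b hab hsub h0 h1 hball φ hφ A hA Φ d hΦ hd
  rw [Metric.tendsto_nhds]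
  intro η hη
  obtain ⟨ε, hε, hb0, hb1⟩ := hball
  obtain ⟨r₀, hr₀, hr⟩ :=
    h3b D D' hsub h0 h1 ⟨ε, hε, hb0, hb1⟩ φ hφ A hA Φ d hΦ hd (η / 2) (by positivity)
  have hpq : D.pt 0 ≠ D.pt 1 := fun h => absurd (D.pt_injective h) (by decide)
  have hdist : 0 < dist (D.pt 0) (D.pt 1) := dist_pos.2 hpq
  set r : ℝ := min (r₀ / 2) (min (ε / 4) (dist (D.pt 0) (D.pt 1) / 8)) with hr_def
  have hrpos : 0 < r := by
    simp only [hr_def, lt_min_iff]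
    exact ⟨by positivity, by positivity, by positivity⟩
  have hr1 : r < r₀ := lt_of_le_of_lt (min_le_left _ _) (by linarith)
  have hr2 : r ≤ ε / 4 := (min_le_right _ _).trans (min_le_left _ _)
  have hr3 : r ≤ dist (D.pt 0) (D.pt 1) / 8 := (min_le_right _ _).trans (min_le_right _ _)
  have hS := hr r ⟨hrpos, hr1⟩
  have hδ : ∀ᶠ δ in 𝓝[>] (0 : ℝ), δ ∈ Set.Ioo (0 : ℝ) r := Ioo_mem_nhdsGT hrpos
  have hδa : ∀ᶠ δ in 𝓝[>] (0 : ℝ), dist (meshPoint δ (a δ)) (D.pt 0) < r :=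
    (Metric.tendsto_nhds.1 hab.tendsto_fst) r hrpos
  have hδb : ∀ᶠ δ in 𝓝[>] (0 : ℝ), dist (meshPoint δ (b δ)) (D.pt 1) < r :=
    (Metric.tendsto_nhds.1 hab.tendsto_snd) r hrpos
  filter_upwards [hS, hδ, hδa, hδb, eventually_greenEntry_pos hab] with δ hSδ hδr hδa' hδb' hpos
  have hbound := h3a D.carrier D'.carrier (D.pt 0) (D.pt 1) ε r δ (a δ) (b δ) (d - η / 2) (d + η / 2)
    D.isBounded hδr.1 hrpos (by linarith [hδr.2]) hb0 hb1 (by linarith [hδr.2]) hδa' hδb' hpos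
    (fun z y hz1 hz2 hy1 hy2 hzy => by
      have h := abs_le.1 (hSδ z y hz1 hz2 hy1 hy2 hzy)
      constructor <;> linarith [h.1, h.2])
  rw [Real.dist_eq, abs_lt]
  constructor <;> linarith [hbound.1, hbound.2]

/-- **The anchor is a theorem of the two provable-now stubs**: `Determinantal ∧ ExcursionRatio ⇒
SymplecticAnchor`. -/
theorem symplecticAnchor_of (h2 : Determinantal) (h3 : ExcursionRatio) : SymplecticAnchor := by
  intro D D' a b hab hsub h0 h1 hball φ hφ A hA Φ d hΦ hd
  refine (h3 D D' a b hab hsub h0 h1 hball φ hφ A hA Φ d hΦ hd).congr' ?_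
  filter_upwards [eventually_good hab] with δ hδ
  exact (Rδ_anchor_eq_greenRatio h2 hδ.2.2.1 hδ.2.2.2 hδ.2.1).symm

/-- The inline hull hypotheses of the crux give the tree's `IsHullSubdomain` (ball agreement ⇒ the
marked points are off `closure (D ∖ D')`). -/
theorem isHullSubdomain_of_ball {D D' : DobrushinDomain} (hsub : D'.carrier ⊆ D.carrier)
    (h0 : D'.pt 0 = D.pt 0) (h1 : D'.pt 1 = D.pt 1)
    (hball : ∃ ε : ℝ, 0 < ε ∧ D'.carrier ∩ Metric.ball (D.pt 0) ε = D.carrier ∩ Metric.ball (D.pt 0) ε ∧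
      D'.carrier ∩ Metric.ball (D.pt 1) ε = D.carrier ∩ Metric.ball (D.pt 1) ε) :
    D.IsHullSubdomain D' := by
  obtain ⟨ε, hε, hb0, hb1⟩ := hball
  have key : ∀ p : ℂ, D'.carrier ∩ Metric.ball p ε = D.carrier ∩ Metric.ball p ε →
      p ∉ closure (D.carrier \ D'.carrier) := by
    intro p hp hmem
    rw [mem_closure_iff_nhds] at hmem
    obtain ⟨z, hzb, hzD, hzD'⟩ := hmem (Metric.ball p ε) (Metric.ball_mem_nhds p hε)
    have hz : z ∈ D'.carrier ∩ Metric.ball p ε := by rw [hp]; exact ⟨hzD, hzb⟩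
    exact hzD' hz.1
  exact ⟨hsub, h0, h1, key _ hb0, key _ hb1⟩

/-- **The composition (kernel-checked, no `sorry` here): the registered stubs imply the crux
`AvoidanceLimit` BY NAME** (v13: the OPEN stubs germTS, S4, S5 are the hypotheses; germCR ⇐ germTS by `germCrossRatio_of_twoSided`; UBHP ⇐ germCR by the tree's germ-region iteration and the landed dictionary; the closed S1, S2, S3a, TOP, GC (⇐ the
discharged CW33), S6, S7 are used as the landed theorems they now are; BHP ⇐ UBHP and INT ⇐ GC by the landed reductions;
S3 = `excursionRatio_of` S3a (TOP+BHP+INT)). Anchor (`S2 + S3`) ⇒ window (`S4`) on `(-2, -2+ε₀]` along `xcDim`;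
continuation (`S5`) at `η = ε₀/2`; Vitali transport (`S6`) of `d^{bExp}` from the overlap
`(-2+ε₀/2, -2+ε₀)` to `0` (with `0 < d` from the chordal pull-back being a `*`-hull); the curve hits
the SAW point (`S7`); the ratio at `(0,0,x_c)` is the avoidance probability (`S1`). -/
theorem AvoidanceLimit_of :
    Registered.stub_germUpper →
      Registered.stub_symplecticWindow → Registered.stub_fugacityContinuation → AvoidanceLimit := by
  intro hUP h4 h5 D D' a b hab hsub hp0 hp1 hball φ hφ A hA Φ d hΦ hd
  -- v14: the two-sided factorisation from the upper bound at the hub (hub and lower bound landed)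
  have hTS : Registered.stub_germTwoSided := germTwoSided_of_upper hUP
  -- v13: germCR from the two-sided hub factorisation (glue `germCrossRatio_of_twoSided`); v12: UBHP derived from germCR by
  -- Chelkak–Wan's iteration over germ regions (tree) + the landed dictionary
  have hCR : Registered.stub_germCrossRatio := germCrossRatio_of_twoSided hTS
  have hU : Registered.stub_uniformBHP :=
    Theorems.AvoidanceLimit.Anchor.uniformBHP_of_germCrossRatio hCR
  -- TOP closed (landed), BHP from UBHP (landed reduction), GC closed (landed: c2 sandwich + discharged CW33), INT from GC
  -- (landed reduction), S3b assembled (landed assembly), S3a closed (landed), S3 = excursionRatio_of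
  have hG : Registered.stub_greenConvergence :=
    Theorems.AvoidanceLimit.Anchor.stub_greenConvergence_of_killedGreen_tendsto stub_killedGreenKernelConvergence
  have hT : Registered.stub_latticeTopology := stub_latticeTopology
  have hB : Registered.stub_ratioOscillation :=
    Theorems.AvoidanceLimit.Anchor.stub_ratioOscillation_of_uniformBHP hU
  have hI : Registered.stub_interiorRatioLimit :=
    Theorems.AvoidanceLimit.Anchor.stub_interiorRatioLimit_of_greenConvergence hG
  have h3a : Registered.stub_greenRatioDecomposition := stub_greenRatioDecomposition
  have h3b : Registered.stub_sphereRatioLimit :=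
    Theorems.AvoidanceLimit.Anchor.stub_sphereRatioLimit_of_oscillation_of_interiorLimit hT hB hI
  have h3 : ExcursionRatio := excursionRatio_of h3a h3b
  -- the four CLOSED stubs (landed theorems): S1, S2, S6, S7
  have h1 : Registered.stub_sawEndpoint := stub_sawEndpoint
  have h2 : Registered.stub_determinantal := stub_determinantal
  have h6 : Registered.stub_vitaliTransport := stub_vitaliTransport
  have h7 : Registered.stub_sawCriticalPoint := stub_sawCriticalPoint
  -- (0) `0 < d`: the pulled-back hull of a hull subdomain under a CHORDAL uniformizer is a `*`-hull.
  have hHull : D.IsHullSubdomain D' := isHullSubdomain_of_ball hsub hp0 hp1 hball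
  have hstar : IsStarHull A := by
    rw [hA]
    exact IsStarHull.pullbackHull JordanDomain.isSimplyConnected_holds hφ hHull
  obtain ⟨d', hd'0, -, hd'⟩ := IsStarHull.exists_hasRestrictionDeriv_holds hstar hΦ
  have hdpos : 0 < d := by rwa [hd.unique hstar hd']
  -- (1) the anchor, (2) the window
  have hAnchor : SymplecticAnchor := symplecticAnchor_of h2 h3
  obtain ⟨ε₀, hε₀, hε₁, hW⟩ := h4 hAnchor
  -- (3) continuation at `η = ε₀ / 2`
  obtain ⟨U, Xc, hUo, hUc, hUstrip, hUseg, -, hXreal, hB⟩ :=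
    h5 (ε₀ / 2) (by positivity) (by linarith)
  obtain ⟨δ₀, hδ₀, M, hFM⟩ := hB D D' a b hab hsub hp0 hp1 hball
  -- the family to transport
  set f : ℝ → ℂ → ℂ := fun δ z => Rδ z (z / 2) (Xc z) D.carrier D'.carrier δ (a δ) (b δ) with hf
  have hreal : ∀ s : ℝ, (s : ℂ) ∈ U → s ≤ 0 → ∀ δ,
      f δ s = ((Rδ s (s / 2) (xcDim s (s / 2)) D.carrier D'.carrier δ (a δ) (b δ) : ℝ) : ℂ) := by
    intro s hsU hs0 δ
    simp only [hf]
    rw [hXreal s hsU hs0, show (s : ℂ) / 2 = ((s / 2 : ℝ) : ℂ) by push_cast; ring, Rδ_ofReal]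
  -- (4) pointwise limits on the overlap `(-2 + ε₀/2, -2 + ε₀)` from the window
  have hlim : ∀ s ∈ Set.Ioo (-2 + ε₀ / 2) (-2 + ε₀),
      Tendsto (fun δ => f δ s) (𝓝[>] 0) (𝓝 ((d ^ bExp s : ℝ) : ℂ)) := by
    intro s hs
    have hsU : (s : ℂ) ∈ U := hUseg s ⟨hs.1.le, by linarith [hs.2]⟩
    have hs0 : s ≤ 0 := by linarith [hs.2]
    have hw := hW s ⟨by linarith [hs.1], hs.2.le⟩ D D' a b hab hsub hp0 hp1 hball φ hφ A hA Φ d hΦ hd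
    have hfun : (fun δ => f δ s) =
        fun δ => ((Rδ s (s / 2) (xcDim s (s / 2)) D.carrier D'.carrier δ (a δ) (b δ) : ℝ) : ℂ) :=
      funext (hreal s hsU hs0)
    rw [hfun]
    exact (Complex.continuous_ofReal.tendsto _).comp hw
  -- (5) Vitali transport to `0`
  have key := h6 (ε₀ / 2) (by positivity) (by linarith) U hUo hUc hUstrip hUseg f M δ₀ hδ₀ hFM d hdpos
    (-2 + ε₀ / 2) (-2 + ε₀) le_rfl (by linarith) (by linarith) hlim
  -- (6) at `0` the curve is the SAW point
  have h0U : ((0 : ℝ) : ℂ) ∈ U := hUseg 0 ⟨by linarith, le_rfl⟩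
  have hf0 : ∀ δ, f δ 0 =
      ((Rδ (0 : ℝ) 0 SAW.criticalFugacity D.carrier D'.carrier δ (a δ) (b δ) : ℝ) : ℂ) := by
    intro δ
    have h7' : xcDim 0 0 = SAW.criticalFugacity := h7
    have h := hreal 0 h0U le_rfl δ
    rw [zero_div, h7'] at h
    simpa using h
  have hC : Tendsto (fun δ => ((Rδ (0 : ℝ) 0 SAW.criticalFugacity D.carrier D'.carrier δ (a δ) (b δ) : ℝ) : ℂ))
      (𝓝[>] 0) (𝓝 ((d ^ ((5 : ℝ) / 8) : ℝ) : ℂ)) := by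
    have hfun : (fun δ => f δ 0) =
        fun δ => ((Rδ (0 : ℝ) 0 SAW.criticalFugacity D.carrier D'.carrier δ (a δ) (b δ) : ℝ) : ℂ) :=
      funext hf0
    rw [← hfun]
    exact key
  have hR : Tendsto (fun δ => Rδ (0 : ℝ) 0 SAW.criticalFugacity D.carrier D'.carrier δ (a δ) (b δ))
      (𝓝[>] 0) (𝓝 (d ^ ((5 : ℝ) / 8))) := by
    have h := (Complex.continuous_re.tendsto _).comp hC
    rw [Complex.ofReal_re] at h
    exact h.congr' (Eventually.of_forall fun δ => Complex.ofReal_re _)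
  -- (7) the ratio at `(0, 0, x_c)` is the avoidance probability, eventually in `δ`
  refine (ENNReal.tendsto_ofReal hR).congr' ?_
  filter_upwards [eventually_good hab] with δ hδ
  exact (h1 D.carrier D'.carrier δ (a δ) (b δ) D.isBounded hδ.1 hδ.2.1).symm

/-- Hypothesis-free form of the skeleton: the crux modulo the three sorried stubs (germTS, S4, S5). -/
example : AvoidanceLimit :=
  AvoidanceLimit_of stub_germUpper stub_symplecticWindow stub_fugacityContinuation

/-! ## 7. Checks against the landed `Negative/` lemmas (imported) -/

/-- The value the line produces is THE exponent of the crux family (`avoidanceLimitExp_iff`), and the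
crux excludes every other exponent (`avoidanceLimit_not_exp`): the line's `5/8` is `bExp 0`, not an
exponent-blind covariance statement. -/
example : bExp 0 = 5 / 8 ∧
    (AvoidanceLimit → ¬ Theorems.AvoidanceLimit.Negative.AvoidanceLimitExp 1) :=
  ⟨bExp_zero, fun h => Theorems.AvoidanceLimit.Negative.avoidanceLimit_not_exp_one h⟩

end Summit.CriticalPhenomena.SAWScalingLimit.Cruxes.AvoidanceLimit.SymplecticFermionAnchor

end
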